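import Literature.AlgebraicGeometry.Villaflor2022.LinearCyclePeriodsIntegral
import Mathlib.NumberTheory.Cyclotomic.Basic
import Mathlib.FieldTheory.Galois.Basic
import HarnessLib

/-!
# Fake linear cycles meet all linear cycles rationally
# (Duque Franco–Villaflor, ANT 17 (2023), Thm. 1.1, Thms. 5.2–5.4; Villaflor, CCM 24 (2022), §6) — algebraic core

Certified instances and evidence bearing on the general Hodge conjecture; no claim.

J. Duque Franco, R. Villaflor Loyola, *On fake linear cycles inside Fermat varieties*, Algebra Number Theory 17
(2023) 1847–1865 = arXiv:2112.14818 [DuquefrancoVillaflorloyola2023] (held text pp. 3–4, 10–12):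

> **Theorem 1.1.** For `d = 3, 4, 6 ≥ 2 + 6/n` and `n` even, there are infinitely many scheme-theoretically different
> Hodge loci `V_λ` associated to non-trivial Hodge cycles of the Fermat variety `λ ∈ H^{n/2,n/2}(X_0) ∩ H^n(X_0,ℤ)` such
> that `codim T_0V_λ = C(n/2+d, d) − (n/2+1)²`. In particular, infinitely many of these Hodge cycles are not linear
> cycles. We call them *fake linear cycles*. All fake linear cycles are of the form `λ_prim = res(P_λ Ω / F^{n/2+1})`
> where `P_λ` is given (up to some relabeling of the coordinates) by
> `P_λ = c_λ ∏_{j=1}^{n/2+1} (x_{2j−2}^{d−1} − (c_{2j−2} x_{2j−1})^{d−1}) / (x_{2j−2} − c_{2j−2} x_{2j−1})`,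
> where `c_0, c_2, …, c_n ∈ ζ_{2d}^{−3}·𝕊¹_{ℚ(ζ_d)} = {ζ_{2d}^{−3}·z ∈ ℚ(ζ_{2d}) : z ∈ ℚ(ζ_d) and |z| = 1}` but not all
> being `d`-th roots of `−1` simultaneously, and `c_λ ∈ ℚ(ζ_{2d})^×`. Moreover, for any such choice of `c_i`'s, there
> exists some `c_λ ∈ ℚ(ζ_{2d})^×` such that the class `λ_prim` […] is the class of a fake linear cycle.
> "We point out that the condition on the `c_i`'s not all being `d`-th roots of `−1` simultaneously is to avoid that
> `λ_prim` becomes the class of a true linear cycle."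

> **Thms. 5.2–5.4** (`d = 3, 4, 6`; the action of `Gal(ℚ(ζ_{2d})/ℚ)` on the twists). `d = 4` (p. 11):
> "`Gal(ℚ(ζ_8)/ℚ) = {id, σ_3, σ_5, σ_7}` where `σ_j(ζ_8) = ζ_8^j` […] for every `α ∈ ζ_8·𝕊¹_{ℚ(i)}` we have
> `σ_3(α) = −ᾱ`, `σ_5(α) = −α`, `σ_7(α) = ᾱ`"; `d = 6` (p. 12): "`σ_5(α) = −ᾱ`, `σ_7(α) = −α`, `σ_11(α) = ᾱ`";
> `d = 3` (p. 11): "`σ(α) = ᾱ`". (`|α| = 1`, so `ᾱ = α^{−1}`.) The class `λ` is then `Gal`-invariant for a suitable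
> `c_λ` (Hilbert's Theorem 90), i.e. rational.

R. Villaflor Loyola, *Small codimension components of the Hodge locus containing the Fermat variety*, Commun.
Contemp. Math. 24 (2022) = arXiv:2001.01019 [Villaflorloyola2021], §6 (held text p. 13): "for every `d = 3, 4, 6` the
following sets `G_d` are constituted by elements satisfying (arthcond1) as can be easily verified:
`G_3 := 𝕊¹_{ℚ(ζ_3)}`, `G_4 := ζ_8·𝕊¹_{ℚ(i)}`, `G_6 := i·𝕊¹_{ℚ(ζ_3)}`. For every `a = (a_0, a_2, …, a_n) ∈ G_d^{n/2+1}`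
define `λ_a := res(P_a Ω/F^{n/2+1})^{n/2,n/2}` […] `P_a := c_a ∏ (x_{2i−2}^{d−1} − (a_{2i−2}x_{2i−1})^{d−1})/(x_{2i−2} − a_{2i−2}x_{2i−1})`
[…] the intersection of `λ` with `δ = [ℙ^{n/2}_α]` is equal (up to multiplication by a non-zero rational number) to
`c_a·c_α` […] Now it is clear that (intnumb) is rational for any `α`, since every `a_{2i−2}` satisfies (arthcond1).
**With a little more effort it is possible to show that in fact the intersection of `λ_a` with all linear cycles
contained in the Fermat variety (which can be obtained from the `ℙ^{n/2}_α`'s after permuting the coordinates of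
`ℙ^{n+1}`) is also a rational number.**"

## What this file PROVES (0 facts, 0 sorry)

In the tree, a Hodge class of the Fermat variety enters through its period functional (Movasati; see the module
docs of `Villaflor2022/LinearFormsCutLinearCycle.lean`), and "rational Hodge class" becomes hypothesis **(H2)** of
`Villaflor2022.exists_fakeLinearCycle_of_rational_periods` (Villaflor's Thm. 1.2 formalised): the periods
`ℓ(P_δ/c_δ)` over ALL linear cycles `δ = (θ, c'')` of `X` (`c''_j^d = −1`, any pairing `θ` of the coordinates) are
rational multiples of one constant. `Villaflor2022.linearCycle_rational_periods` proves (H2) for the functional of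
every GENUINE linear cycle. Here:

* `IsFakeTwist d ζ a` — the set `ζ_{2d}^{−3}·𝕊¹_{ℚ(ζ_d)}` of Thm. 1.1 (= `G_d` of [Villaflorloyola2021] §6), for
  `ζ` a primitive `2d`-th root of unity and `d ∈ {3, 4, 6}` (`ℚ(ζ_d) = ℚ ⊕ ℚζ²`, `|z|² = z·z̄`, `z̄ : ζ² ↦ ζ^{−2}`):
  `a = ζ^{−3}(p + qζ²)`, `p, q ∈ ℚ`, `(p + qζ²)(p + qζ^{−2}) = 1`; `isFakeTwist_of_pow_eq_neg_one`: every genuine twist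
  (`c^d = −1`) is in the set ("not all being `d`-th roots of `−1`" is what separates fake from true linear cycles);
  `infinite_setOf_isFakeTwist_not_pow_eq`: the set contains INFINITELY MANY elements with `a^d ≠ −1` (Thm. 1.1:
  "infinitely many of these Hodge cycles are not linear cycles" — the rational points `t ↦ ((t²−1) + t(2−τt)ζ²)/(t²−τt+1)`
  of the norm-one conic, `τ = ζ² + ζ^{−2} ∈ {−1, 0, 1}`, against the at most `d` roots of `x^d = −1`).
* `periodSum d ρ a c''` and `fermatLinearCycleFunctional_rename_eq_periodSum`: a CLOSED finite-sum formula for the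
  period `ℓ_a(P_{c''} ∘ ρ)` of the functional `ℓ_a = coeff_{∏ y_j^{d−2}} ∘ (x_{2j} ↦ a_j y_j, x_{2j+1} ↦ y_j)` with
  twists `a` over a linear cycle with twists `c''` in ARBITRARY relative position `ρ : T ⊕ T ≃ ι ⊕ ι` — valid for
  all `a`, `c''` over any field (the tree's `linearCyclePairing_integral` bounds this number for genuine `a` without
  a closed form).
* `periodSum_neg_neg` (`d` even: `periodSum(−a, −c'') = periodSum(a, c'')`) and `periodSum_inv_inv`
  (`periodSum(a^{−1}, c''^{−1}) = ((∏ a)(∏ c''))^{−(d−2)} periodSum(a, c'')`) — the two symmetries through which the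
  Galois group acts; `map_periodSum` (functoriality).
* `autAction_fakeTwist` (Thms. 5.2–5.4, the displayed action): over a field `E ⊇ ℚ` containing a primitive `2d`-th
  root `ζ`, `d ∈ {3,4,6}`, every `f ∈ Aut(E/ℚ)` acts on ALL fake (hence all genuine) twists uniformly as `w ↦ ε w`
  or as `w ↦ ε w^{−1}`, `ε = ±1` (`ε = −1` only for `d` even).
* **`fakeLinearCycle_rational_periods`** (Thm. 1.1 "`λ` is a Hodge class" / §6 "the intersection of `λ_a` with all
  linear cycles is rational" — algebraic core): `K` any field of characteristic `0`, `ζ ∈ K` a primitive `2d`-th root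
  of unity, `d ∈ {3, 4, 6}`, `a_j ∈ ζ^{−3}·𝕊¹_{ℚ(ζ_d)}` for all `j`: **(H2) HOLDS for `ℓ = c'·ℓ_a ∘ rename θ₀^{−1}`** —
  for some `c₀` and every linear cycle `(θ, c'')`, `ℓ(linearCyclePoly (d−1) θ c'') ∈ ℚ·c₀` — verbatim the hypothesis
  `hrat` of `exists_fakeLinearCycle_of_rational_periods`; and `fake_pairPeriod_ratio_rational`: (arthcond1) holds
  on `G_d` ("as can be easily verified"; one pair, same position: `periodSum_refl_unit` = the tree's `pairSum`).
* **`exists_fakeLinearCycleFunctional_rank_eq`** (Thm. 1.1, first part: "there are … Hodge cycles … such that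
  `codim T_0V_λ = C(n/2+d,d) − (n/2+1)²` … not linear cycles … Our main result disproves [Movasati's] conjecture for
  `d = 3, 4, 6`"), in the census vocabulary of `Villaflor2022.exists_linearCycleFunctional_of_rank_eq` (Villaflor's
  Thm. 1.1, `d ∉ {3,4,6}`): for `d ∈ {3,4,6}`, `n` even, `n + 2 ≤ (n/2)d`, there is a functional on `K[x_0,…,x_{n+1}]`
  killing `J^F`, concentrated in degree `(n/2+1)(d−2)`, non-zero, with `rank [p_{i+j}] = C(n/2+d,d) − (n/2+1)²` for
  Movasati's matrix `Movasati2016.periodMatrix (n+2) d ((n/2)d−n−2) d`, satisfying (H2) over the cycles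
  `ℙ^{n/2}_{a,b}` (`linearCyclePolyMV`), and NOT of the form `c'·ℓ_{a,b}` (`MovasatiVillaflor2018.linearCycleFunctional`)
  — every hypothesis of the formalised Thm. 1.1 except `d ∉ {3,4,6}` holds and its conclusion fails.
* `periodSum_refl`, `mul_mul_pairSum_eq`, **`prod_mul_fermatLinearCycleFunctional_eq`** ([Villaflor2022PeriodsCI]
  Cor. 4, the SAME pairing, all `d ≥ 2`, genuine twists): the period sum factorises over the pairs, each pair
  contributes Cor. 4's "`1 − d` if `α_{2j−2} = β_{2j−2}`, `1` if not" after normalisation, and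
  `(∏ a)(∏ c)·ℓ_a(P_c) = (1 − d)^{#{t : a_t = c_t}}` exactly — the algebraic shadow of
  "`ℙ_α·ℙ_β = (1 − (1−d)^{m+1})/d`, `m = dim ℙ_α ∩ ℙ_β`" (the tree's `linearCyclePairing_integral` gives `∈ ℤ` for
  arbitrary position without the value).

Method (the "little more effort", supplied here by algebra in place of the transcendental [Villaflorloyola2021]
Prop. 5.1): by the closed formula and the two symmetries, `f((∏ c'')·periodSum) = μ_f·(∏ c'')·periodSum` with
`μ_f = ε^{k+1}` resp. `ε^{k+1}(−1)^{k+1}(∏ a_j)^{−(d−2)}` INDEPENDENT of the linear cycle (`aut_prod_mul_periodSum`);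
so the ratio of the periods over two linear cycles is fixed by `Aut(ℚ(ζ)/ℚ)`, hence rational
(`IsGalois.mem_range_algebraMap_iff_fixed`, with `ℚ(ζ) = ℚ⟮ζ⟯ ⊂ K` a cyclotomic, hence finite Galois, extension of
`ℚ`). The constant `c_λ ∈ ℚ(ζ_{2d})^×` of Thm. 1.1 (Hilbert 90) normalises the class itself and is not needed for
the RATIOS, which is what (H2) asks. The parity step of `periodSum_neg_neg` (both pairings partition the slots, and
parities of exponents are constant on the pairs of each) and the reindexing `l ↦ d−2−l` of `periodSum_inv_inv` are
not in print.

References: [DuquefrancoVillaflorloyola2023] Thm. 1.1, Prop. 5.1, Thms. 5.2–5.4; [Villaflorloyola2021] §6,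
Props. 5.1–5.2; [MovasatiVillaflor2018] Thm. 1 (periods of linear cycles); [Villaflor2022PeriodsCI] Cor. 4.
-/

noncomputable section

open MvPolynomial Finset Literature.AlgebraicGeometry.HodgeTheory Literature.AlgebraicGeometry.Villaflor2022
  Literature.AlgebraicGeometry.MovasatiVillaflor2018
open scoped IntermediateField

namespace Literature.AlgebraicGeometry.DuqueFrancoVillaflor2023

variable {K : Type*} [Field K] {ι T : Type*}

/-! ## The set `ζ_{2d}^{-3}·𝕊¹_{ℚ(ζ_d)}` of twists of fake linear cycles (`d ∈ {3,4,6}`) -/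

/-- **The twists of fake linear cycles** (`d ∈ {3, 4, 6}`, `ζ` a primitive `2d`-th root of unity, so that
`ℚ(ζ_d) = ℚ(ζ²) = ℚ ⊕ ℚζ²` is imaginary quadratic with complex conjugation `ζ² ↦ ζ^{−2}`):
`a ∈ ζ_{2d}^{−3}·𝕊¹_{ℚ(ζ_d)} = {ζ_{2d}^{−3} z : z ∈ ℚ(ζ_d), |z| = 1}`, i.e. `a = ζ^{−3}(p + qζ²)` with `p, q ∈ ℚ` and
`|p + qζ²|² = (p + qζ²)(p + qζ^{−2}) = 1`. (These are `G_3 = 𝕊¹_{ℚ(ζ_3)}`, `G_4 = ζ_8·𝕊¹_{ℚ(i)}`, `G_6 = i·𝕊¹_{ℚ(ζ_3)}`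
of [Villaflorloyola2021] §6: `ζ_6^{−3} = −1`, `ζ_8^{−3} = −ζ_8`, `ζ_12^{−3} = −i`, and `−1 ∈ 𝕊¹`. The set does
not depend on the choice of the primitive `2d`-th root `ζ`: another choice `ζ^i`, `i` odd, changes `ζ^{−3}` by the
even power `ζ^{3(1−i)}`, a power of `ζ²` of norm `1`, cf. `exists_pow_sq_eq_lin`.)
[cite: DuquefrancoVillaflorloyola2023, Theorem 1.1] [cite: Villaflorloyola2021, §6] -/
def IsFakeTwist (d : ℕ) (ζ a : K) : Prop :=
  (d = 3 ∨ d = 4 ∨ d = 6) ∧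
    ∃ p q : ℚ, ((p : K) + q * ζ ^ 2) * (p + q * (ζ ^ 2)⁻¹) = 1 ∧ a = (ζ ^ 3)⁻¹ * (p + q * ζ ^ 2)

/-- Unfolding lemma. [cite: DuquefrancoVillaflorloyola2023, Theorem 1.1] -/
theorem isFakeTwist_iff (d : ℕ) (ζ a : K) :
    IsFakeTwist d ζ a ↔ (d = 3 ∨ d = 4 ∨ d = 6) ∧
      ∃ p q : ℚ, ((p : K) + q * ζ ^ 2) * (p + q * (ζ ^ 2)⁻¹) = 1 ∧ a = (ζ ^ 3)⁻¹ * (p + q * ζ ^ 2) :=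
  Iff.rfl

/-- A fake twist is non-zero (`|z| = 1`). [cite: DuquefrancoVillaflorloyola2023, Theorem 1.1] -/
theorem IsFakeTwist.ne_zero {d : ℕ} {ζ a : K} (h : IsFakeTwist d ζ a) (hζ : ζ ≠ 0) : a ≠ 0 := by
  obtain ⟨-, p, q, hN, rfl⟩ := h
  refine mul_ne_zero (inv_ne_zero (pow_ne_zero _ hζ)) ?_
  intro h0
  rw [h0, zero_mul] at hN
  exact zero_ne_one hN

/-- The inverse of a fake twist: `(ζ^{−3} z)^{−1} = ζ³ z̄` (`|z| = 1`). [cite: DuquefrancoVillaflorloyola2023, Theorem 5.3 (proof)] -/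
theorem fakeTwist_inv_eq {ζ : K} {p q : ℚ} (hN : ((p : K) + q * ζ ^ 2) * (p + q * (ζ ^ 2)⁻¹) = 1) :
    ((ζ ^ 3)⁻¹ * (p + q * ζ ^ 2))⁻¹ = ζ ^ 3 * (p + q * (ζ ^ 2)⁻¹) := by
  rw [mul_inv, inv_inv, inv_eq_of_mul_eq_one_right hN]

/-! ### `ℚ(ζ_d) = ℚ ⊕ ℚζ²` for `d ∈ {3, 4, 6}`: the trace of `ζ²` and the powers of `ζ²` -/

/-- For `d ∈ {3, 4, 6}` and `ζ` a primitive `2d`-th root of unity, `ζ² + ζ^{−2} = τ ∈ ℚ` (`τ = −1, 0, 1` for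
`ζ² = ζ_3, i, ζ_6`): `ℚ(ζ_d)` is (imaginary) quadratic exactly when `φ(d) = 2` ("for every `α ∈ ℚ(ζ_6)`, `α = a + bζ_6`
for `a, b ∈ ℚ`"). [cite: DuquefrancoVillaflorloyola2023, Proposition 2.2 and Theorem 5.2 (proof)] -/
theorem exists_sq_add_inv_sq_eq_ratCast [CharZero K] {d : ℕ} (hd : d = 3 ∨ d = 4 ∨ d = 6) {ζ : K}
    (hζ : IsPrimitiveRoot ζ (2 * d)) : ∃ τ : ℚ, (τ = -1 ∨ τ = 0 ∨ τ = 1) ∧ ζ ^ 2 + (ζ ^ 2)⁻¹ = (τ : K) := by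
  have hd0 : 0 < d := by omega
  have hζ0 : ζ ≠ 0 := hζ.ne_zero (by omega)
  have hw0 : ζ ^ 2 ≠ 0 := pow_ne_zero _ hζ0
  have hζd : ζ ^ d = -1 := pow_eq_neg_one_of_isPrimitiveRoot_two_mul hd0 hζ
  -- it suffices to produce `τ` with `(ζ²)² + 1 = τ ζ²`
  suffices H : ∃ τ : ℚ, (τ = -1 ∨ τ = 0 ∨ τ = 1) ∧ (ζ ^ 2) ^ 2 + 1 = (τ : K) * ζ ^ 2 by
    obtain ⟨τ, hτv, hτ⟩ := H
    refine ⟨τ, hτv, ?_⟩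
    have : (ζ ^ 2 + (ζ ^ 2)⁻¹) * ζ ^ 2 = (τ : K) * ζ ^ 2 := by
      rw [add_mul, inv_mul_cancel₀ hw0, ← hτ]; ring
    exact mul_right_cancel₀ hw0 this
  rcases hd with rfl | rfl | rfl
  · -- `d = 3`: `w³ = 1`, `w ≠ 1`, so `w² + w + 1 = 0`
    have hw3 : (ζ ^ 2) ^ 3 = 1 := by
      rw [← pow_mul, show 2 * 3 = 3 * 2 by norm_num, pow_mul, hζd]; norm_num
    have hw1 : ζ ^ 2 ≠ 1 := hζ.pow_ne_one_of_pos_of_lt (by norm_num) (by norm_num)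
    have hsub : ζ ^ 2 - 1 ≠ 0 := sub_ne_zero.mpr hw1
    refine ⟨-1, Or.inl rfl, ?_⟩
    have key : (ζ ^ 2 - 1) * ((ζ ^ 2) ^ 2 + ζ ^ 2 + 1) = 0 := by linear_combination hw3
    rcases mul_eq_zero.mp key with h | h
    · exact absurd h hsub
    · push_cast; linear_combination h
  · -- `d = 4`: `w² = −1`
    refine ⟨0, Or.inr (Or.inl rfl), ?_⟩
    have hw2 : (ζ ^ 2) ^ 2 = -1 := by rw [← pow_mul]; exact hζd
    rw [hw2]; push_cast; ring
  · -- `d = 6`: `w³ = −1`, `w ≠ −1`, so `w² − w + 1 = 0`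
    have hw3 : (ζ ^ 2) ^ 3 = -1 := by rw [← pow_mul]; exact hζd
    have hw1 : ζ ^ 2 + 1 ≠ 0 := by
      intro h
      have h4 : ζ ^ 4 = 1 := by linear_combination (ζ ^ 2 - 1) * h
      exact hζ.pow_ne_one_of_pos_of_lt (by norm_num) (by norm_num) h4
    refine ⟨1, Or.inr (Or.inr rfl), ?_⟩
    have key : (ζ ^ 2 + 1) * ((ζ ^ 2) ^ 2 - ζ ^ 2 + 1) = 0 := by linear_combination hw3
    rcases mul_eq_zero.mp key with h | h
    · exact absurd h hw1
    · push_cast; linear_combination h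

/-- The powers of `w = ζ²` lie in `ℚ ⊕ ℚ w`, compatibly with conjugation: `w^r = p + q w` and `w^{−r} = p + q w^{−1}`
with the same `p, q ∈ ℚ` (`d ∈ {3,4,6}`). [cite: DuquefrancoVillaflorloyola2023, Theorem 5.2 (proof)] -/
theorem exists_pow_sq_eq_lin [CharZero K] {d : ℕ} (hd : d = 3 ∨ d = 4 ∨ d = 6) {ζ : K}
    (hζ : IsPrimitiveRoot ζ (2 * d)) (r : ℕ) :
    ∃ p q : ℚ, (ζ ^ 2) ^ r = (p : K) + q * ζ ^ 2 ∧ ((ζ ^ 2)⁻¹) ^ r = (p : K) + q * (ζ ^ 2)⁻¹ := by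
  have hζ0 : ζ ≠ 0 := hζ.ne_zero (by omega)
  have hw0 : ζ ^ 2 ≠ 0 := pow_ne_zero _ hζ0
  obtain ⟨τ, -, hτ⟩ := exists_sq_add_inv_sq_eq_ratCast hd hζ
  -- the two quadratic relations
  have hw2 : (ζ ^ 2) ^ 2 = (τ : K) * ζ ^ 2 - 1 := by
    have := congrArg (· * ζ ^ 2) hτ
    simp only [add_mul, inv_mul_cancel₀ hw0] at this
    linear_combination this
  have hv2 : ((ζ ^ 2)⁻¹) ^ 2 = (τ : K) * (ζ ^ 2)⁻¹ - 1 := by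
    have := congrArg (· * (ζ ^ 2)⁻¹) hτ
    simp only [add_mul, mul_inv_cancel₀ hw0] at this
    linear_combination this
  induction r with
  | zero => exact ⟨1, 0, by simp, by simp⟩
  | succ r ih =>
    obtain ⟨p, q, h1, h2⟩ := ih
    refine ⟨-q, p + q * τ, ?_, ?_⟩
    · rw [pow_succ, h1]; push_cast; linear_combination (q : K) * hw2
    · rw [pow_succ, h2]; push_cast; linear_combination (q : K) * hv2

/-- **Genuine twists are in the set**: if `c^d = −1` then `c = ζ^{2m+1} = ζ^{−3}·(ζ²)^{m+2}` and `(ζ²)^{m+2}` is an element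
of norm `1` of `ℚ(ζ_d)` — "the condition on the `c_i`'s not all being `d`-th roots of `−1` simultaneously is to avoid
that `λ_prim` becomes the class of a true linear cycle". [cite: DuquefrancoVillaflorloyola2023, Theorem 1.1] -/
theorem isFakeTwist_of_pow_eq_neg_one [CharZero K] {d : ℕ} (hd : d = 3 ∨ d = 4 ∨ d = 6) {ζ c : K}
    (hζ : IsPrimitiveRoot ζ (2 * d)) (hc : c ^ d = -1) : IsFakeTwist d ζ c := by
  have hζ0 : ζ ≠ 0 := hζ.ne_zero (by omega)
  haveI : NeZero (2 * d) := ⟨by omega⟩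
  -- `c` is a `2d`-th root of unity, hence a power of `ζ`
  have hc2d : c ^ (2 * d) = 1 := by rw [mul_comm, pow_mul, hc]; norm_num
  obtain ⟨i, -, rfl⟩ := hζ.eq_pow_of_pow_eq_one hc2d
  -- the exponent is odd
  obtain ⟨m, hm⟩ : ∃ m, i = 2 * m + 1 := by
    rcases Nat.even_or_odd i with ⟨m, rfl⟩ | ⟨m, rfl⟩
    · exfalso
      have h1 : (ζ ^ (m + m)) ^ d = 1 := by
        rw [← pow_mul, show (m + m) * d = (2 * d) * m by ring, pow_mul, hζ.pow_eq_one, one_pow]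
      rw [hc] at h1
      norm_num at h1
    · exact ⟨m, rfl⟩
  subst hm
  obtain ⟨p, q, h1, h2⟩ := exists_pow_sq_eq_lin hd hζ (m + 2)
  refine ⟨hd, p, q, ?_, ?_⟩
  · rw [← h1, ← h2, ← mul_pow, mul_inv_cancel₀ (pow_ne_zero _ hζ0), one_pow]
  · rw [← h1, ← pow_mul, eq_inv_mul_iff_mul_eq₀ (pow_ne_zero _ hζ0), ← pow_add]
    ring_nf

/-! ### Infinitely many fake twists that are not `d`-th roots of `−1` -/

/-- `ζ² = ζ_d ∉ ℚ` (`d ∈ {3,4,6}`): a rational `r` with `r + r^{−1} = τ ∈ {−1, 0, 1}` would satisfy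
`r² − τr + 1 = 0`, which has no real root. [cite: DuquefrancoVillaflorloyola2023, Theorem 5.2 (proof)] -/
theorem sq_ne_ratCast [CharZero K] {d : ℕ} (hd : d = 3 ∨ d = 4 ∨ d = 6) {ζ : K}
    (hζ : IsPrimitiveRoot ζ (2 * d)) (r : ℚ) : ζ ^ 2 ≠ (r : K) := by
  intro h
  have hζ0 : ζ ≠ 0 := hζ.ne_zero (by omega)
  obtain ⟨τ, hτv, hτ⟩ := exists_sq_add_inv_sq_eq_ratCast hd hζ
  rw [h] at hτ
  have hr0 : (r : K) ≠ 0 := h ▸ pow_ne_zero _ hζ0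
  have hr0' : r ≠ 0 := fun h0 => hr0 (by rw [h0, Rat.cast_zero])
  have hq : r * r + 1 = τ * r := by
    have h1 : ((r : K) + (r : K)⁻¹) * r = τ * r := by rw [hτ]
    rw [add_mul, inv_mul_cancel₀ hr0] at h1
    exact_mod_cast h1
  rcases hτv with rfl | rfl | rfl <;> nlinarith [sq_nonneg (2 * r + 1), sq_nonneg (2 * r - 1), sq_nonneg r]

/-- The norm form of `ℚ(ζ_d) = ℚ ⊕ ℚζ²`: `(p + qζ²)(p + qζ^{−2}) = p² + τpq + q²`, `τ = ζ² + ζ^{−2}`.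
[cite: DuquefrancoVillaflorloyola2023, Theorem 5.3 (proof)] -/
theorem fakeTwist_norm_eq {ζ : K} (hζ0 : ζ ≠ 0) (p q : K) :
    (p + q * ζ ^ 2) * (p + q * (ζ ^ 2)⁻¹) = p ^ 2 + (ζ ^ 2 + (ζ ^ 2)⁻¹) * p * q + q ^ 2 := by
  have hw0 : ζ ^ 2 ≠ 0 := pow_ne_zero _ hζ0
  have h1 : ζ ^ 2 * (ζ ^ 2)⁻¹ = 1 := mul_inv_cancel₀ hw0
  linear_combination q ^ 2 * h1

/-- **"Infinitely many of these Hodge cycles are not linear cycles"** — at the level of one twist: for `d ∈ {3,4,6}` the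
set `ζ_{2d}^{−3}·𝕊¹_{ℚ(ζ_d)}` contains infinitely many elements that are NOT `d`-th roots of `−1` (the rational points
`((t²−1) + t(2−τt)ζ²)/(t²−τt+1)` of the norm-one conic `p² + τpq + q² = 1`, `t = 3, 4, 5, …`, are pairwise distinct,
while `x^d = −1` has at most `d` solutions). [cite: DuquefrancoVillaflorloyola2023, Theorem 1.1] -/
theorem infinite_setOf_isFakeTwist_not_pow_eq [CharZero K] {d : ℕ} (hd : d = 3 ∨ d = 4 ∨ d = 6) {ζ : K}
    (hζ : IsPrimitiveRoot ζ (2 * d)) : {a : K | IsFakeTwist d ζ a ∧ a ^ d ≠ -1}.Infinite := by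
  have hd0 : 0 < d := by omega
  have hζ0 : ζ ≠ 0 := hζ.ne_zero (by omega)
  obtain ⟨τ, hτv, hτ⟩ := exists_sq_add_inv_sq_eq_ratCast hd hζ
  have hτle : τ ≤ 1 := by rcases hτv with rfl | rfl | rfl <;> norm_num
  have hτge : -1 ≤ τ := by rcases hτv with rfl | rfl | rfl <;> norm_num
  -- the rational parametrisation of the conic `p² + τpq + q² = 1` by `t = n + 3`, `n ∈ ℕ`
  set D : ℕ → ℚ := fun n => ((n : ℚ) + 3) ^ 2 - τ * ((n : ℚ) + 3) + 1 with hD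
  set P : ℕ → ℚ := fun n => (((n : ℚ) + 3) ^ 2 - 1) / D n with hP
  set Q : ℕ → ℚ := fun n => ((n : ℚ) + 3) * (2 - τ * ((n : ℚ) + 3)) / D n with hQ
  have hDpos : ∀ n, 0 < D n := fun n => by
    simp only [hD]; nlinarith [sq_nonneg ((n : ℚ) + 3), (by positivity : (0 : ℚ) ≤ n)]
  have hnorm : ∀ n, P n ^ 2 + τ * P n * Q n + Q n ^ 2 = 1 := by
    intro n
    have hDn : D n ≠ 0 := (hDpos n).ne'
    simp only [hP, hQ]
    field_simp
    simp only [hD]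
    ring
  have hone : ∀ n, 1 - P n ≠ 0 := by
    intro n h
    have hDn : D n ≠ 0 := (hDpos n).ne'
    have h' : D n - (((n : ℚ) + 3) ^ 2 - 1) = 0 := by
      have := congrArg (· * D n) h
      simpa only [sub_mul, one_mul, hP, div_mul_cancel₀ _ hDn, zero_mul] using this
    simp only [hD] at h'
    -- `2 = τ (n+3)` is impossible for `|τ| ≤ 1`
    rcases hτv with rfl | rfl | rfl
    · nlinarith [(by positivity : (0 : ℚ) ≤ n)]
    · norm_num at h'
    · have : (n : ℚ) + 1 = 0 := by linear_combination (-1 : ℚ) * h'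
      have : (0 : ℚ) ≤ n := by positivity
      linarith
  have hrecover : ∀ n, Q n / (1 - P n) = (n : ℚ) + 3 := by
    intro n
    have hDn : D n ≠ 0 := (hDpos n).ne'
    rw [div_eq_iff (hone n)]
    simp only [hP, hQ]
    field_simp
    simp only [hD]
    ring
  -- the family of fake twists
  set f : ℕ → K := fun n => (ζ ^ 3)⁻¹ * ((P n : K) + (Q n : K) * ζ ^ 2) with hf
  have hfake : ∀ n, IsFakeTwist d ζ (f n) := by
    intro n
    refine ⟨hd, P n, Q n, ?_, rfl⟩
    rw [fakeTwist_norm_eq hζ0, hτ]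
    exact_mod_cast hnorm n
  have hinj : Function.Injective f := by
    intro n₁ n₂ h
    simp only [hf] at h
    have h' : (P n₁ : K) + (Q n₁ : K) * ζ ^ 2 = (P n₂ : K) + (Q n₂ : K) * ζ ^ 2 :=
      mul_left_cancel₀ (inv_ne_zero (pow_ne_zero _ hζ0)) h
    have hQ12 : Q n₁ = Q n₂ := by
      by_contra hne
      have hne' : ((Q n₁ - Q n₂ : ℚ) : K) ≠ 0 := by
        rw [Ne, Rat.cast_eq_zero, sub_eq_zero]; exact hne
      apply sq_ne_ratCast hd hζ ((P n₂ - P n₁) / (Q n₁ - Q n₂))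
      rw [Rat.cast_div, eq_div_iff hne']
      push_cast
      linear_combination h'
    have hP12 : P n₁ = P n₂ := by
      have : (P n₁ : K) = (P n₂ : K) := by
        have := h'; rw [hQ12] at this; exact add_right_cancel this
      exact_mod_cast this
    have := hrecover n₁
    rw [hQ12, hP12, hrecover n₂] at this
    exact_mod_cast (by linarith : (n₁ : ℚ) = n₂)
  -- the `d`-th roots of `−1` are finitely many
  have hfin : {a : K | a ^ d = -1}.Finite := by
    refine (Polynomial.finite_setOf_isRoot (Polynomial.X_pow_sub_C_ne_zero hd0 (-1 : K))).subset ?_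
    intro a ha
    simp only [Set.mem_setOf_eq] at ha ⊢
    rw [Polynomial.IsRoot, Polynomial.eval_sub, Polynomial.eval_pow, Polynomial.eval_X, Polynomial.eval_C, ha,
      sub_self]
  refine ((Set.infinite_range_of_injective hinj).sdiff hfin).mono ?_
  rintro a ⟨⟨n, rfl⟩, ha⟩
  exact ⟨hfake n, ha⟩

/-! ## The period of `ℓ_a` over a linear cycle in arbitrary position: a closed formula -/

section PeriodSum

variable [Fintype ι] [Fintype T] [DecidableEq ι] [DecidableEq T]

/-- The exponent vector of the term `l` of `∏_t P_t ∘ ρ`: the slot `ρ(t,0)` carries `l_t`, the slot `ρ(t,1)` carries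
`d − 2 − l_t`. [cite: Villaflorloyola2021, Proposition 5.2] -/
def slotExp (d : ℕ) (ρ : T ⊕ T ≃ ι ⊕ ι) (l : T → ℕ) : ι ⊕ ι →₀ ℕ :=
  ∑ t, (Finsupp.single (ρ (Sum.inl t)) (l t) + Finsupp.single (ρ (Sum.inr t)) (d - 2 - l t))

/-- **The period sum.** `periodSum d ρ a c'' = Σ_{l : T → [0, d−2]} [∀ j, e_l(j,0) + e_l(j,1) = d − 2]·∏_t c''_t^{d−2−l_t}·∏_j a_j^{e_l(j,0)}`,
`e_l = slotExp d ρ l`: the value `ℓ_a(P_{c''} ∘ ρ)` of the functional `coeff_{∏ y_j^{d−2}} ∘ (x_{j,0} ↦ a_j y_j, x_{j,1} ↦ y_j)`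
on the product `∏_t Σ_l x_{ρ(t,0)}^l (c''_t x_{ρ(t,1)})^{d−2−l}` (`fermatLinearCycleFunctional_rename_eq_periodSum`).
[cite: Villaflorloyola2021, Propositions 5.1 and 5.2, §6] [cite: MovasatiVillaflor2018, Theorem 1] -/
def periodSum (d : ℕ) (ρ : T ⊕ T ≃ ι ⊕ ι) (a : ι → K) (c : T → K) : K :=
  ∑ l ∈ Fintype.piFinset (fun _ : T => range (d - 1)),
    if ∀ j, slotExp d ρ l (Sum.inl j) + slotExp d ρ l (Sum.inr j) = d - 2 then
      (∏ t, c t ^ (d - 2 - l t)) * ∏ j, a j ^ slotExp d ρ l (Sum.inl j) else 0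

omit [Fintype ι] [DecidableEq T] in
/-- The slot `ρ(t,0)` carries `l_t`. [cite: Villaflorloyola2021, Proposition 5.2] -/
theorem slotExp_apply_inl (d : ℕ) (ρ : T ⊕ T ≃ ι ⊕ ι) (l : T → ℕ) (t : T) :
    slotExp d ρ l (ρ (Sum.inl t)) = l t := by
  rw [slotExp, Finsupp.coe_finsetSum, Finset.sum_apply, Finset.sum_eq_single t]
  · have h2 : ¬ ρ (Sum.inr t) = ρ (Sum.inl t) := fun h => Sum.inr_ne_inl (ρ.injective h)
    rw [Finsupp.add_apply, Finsupp.single_eq_same, Finsupp.single_apply, if_neg h2, add_zero]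
  · intro t' _ ht'
    have h1 : ¬ ρ (Sum.inl t') = ρ (Sum.inl t) := fun h => ht' (Sum.inl_injective (ρ.injective h))
    have h2 : ¬ ρ (Sum.inr t') = ρ (Sum.inl t) := fun h => Sum.inr_ne_inl (ρ.injective h)
    rw [Finsupp.add_apply, Finsupp.single_apply, Finsupp.single_apply, if_neg h1, if_neg h2, add_zero]
  · intro h; exact absurd (Finset.mem_univ t) h

omit [Fintype ι] [DecidableEq T] in
/-- The slot `ρ(t,1)` carries `d − 2 − l_t`. [cite: Villaflorloyola2021, Proposition 5.2] -/
theorem slotExp_apply_inr (d : ℕ) (ρ : T ⊕ T ≃ ι ⊕ ι) (l : T → ℕ) (t : T) :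
    slotExp d ρ l (ρ (Sum.inr t)) = d - 2 - l t := by
  rw [slotExp, Finsupp.coe_finsetSum, Finset.sum_apply, Finset.sum_eq_single t]
  · have h2 : ¬ ρ (Sum.inl t) = ρ (Sum.inr t) := fun h => Sum.inl_ne_inr (ρ.injective h)
    rw [Finsupp.add_apply, Finsupp.single_eq_same, Finsupp.single_apply, if_neg h2, zero_add]
  · intro t' _ ht'
    have h1 : ¬ ρ (Sum.inl t') = ρ (Sum.inr t) := fun h => Sum.inl_ne_inr (ρ.injective h)
    have h2 : ¬ ρ (Sum.inr t') = ρ (Sum.inr t) := fun h => ht' (Sum.inr_injective (ρ.injective h))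
    rw [Finsupp.add_apply, Finsupp.single_apply, Finsupp.single_apply, if_neg h1, if_neg h2, add_zero]
  · intro h; exact absurd (Finset.mem_univ t) h

omit [Fintype ι] [DecidableEq T] in
/-- The exponent of the slot `x` is the weight of the slot `ρ^{−1} x` of `δ`. [cite: Villaflorloyola2021, Proposition 5.2] -/
theorem slotExp_apply (d : ℕ) (ρ : T ⊕ T ≃ ι ⊕ ι) (l : T → ℕ) (x : ι ⊕ ι) :
    slotExp d ρ l x = Sum.elim l (fun t => d - 2 - l t) (ρ.symm x) := by
  obtain ⟨y, rfl⟩ := ρ.surjective x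
  rw [Equiv.symm_apply_apply]
  rcases y with t | t
  · rw [slotExp_apply_inl, Sum.elim_inl]
  · rw [slotExp_apply_inr, Sum.elim_inr]

omit [Fintype ι] [DecidableEq T] in
/-- Every exponent is at most `d − 2`. [cite: Villaflorloyola2021, Proposition 5.2] -/
theorem slotExp_le (d : ℕ) (ρ : T ⊕ T ≃ ι ⊕ ι) {l : T → ℕ} (hl : ∀ t, l t ≤ d - 2) (x : ι ⊕ ι) :
    slotExp d ρ l x ≤ d - 2 := by
  rw [slotExp_apply]
  rcases ρ.symm x with t | t
  · exact hl t
  · exact Nat.sub_le _ _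

omit [Fintype ι] [DecidableEq T] in
/-- The complementary term `l ↦ d − 2 − l` complements every exponent. [cite: Villaflorloyola2021, Proposition 5.2] -/
theorem slotExp_bar (d : ℕ) (ρ : T ⊕ T ≃ ι ⊕ ι) {l : T → ℕ} (hl : ∀ t, l t ≤ d - 2) (x : ι ⊕ ι) :
    slotExp d ρ (fun t => d - 2 - l t) x = d - 2 - slotExp d ρ l x := by
  rw [slotExp_apply, slotExp_apply]
  have := hl
  rcases ρ.symm x with t | t <;> rfl

omit [Fintype ι] [Fintype T] [DecidableEq ι] [DecidableEq T] in
/-- One term of `P_t ∘ ρ`: `x_{ρ(t,0)}^l (c_t x_{ρ(t,1)})^{e} = c_t^e · x^{l[ρ(t,0)] + e[ρ(t,1)]}`. [folklore] -/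
private theorem term_eq_monomial (ρ : T ⊕ T ≃ ι ⊕ ι) (c : T → K) (t : T) (l e : ℕ) :
    (X (ρ (Sum.inl t)) : MvPolynomial (ι ⊕ ι) K) ^ l * (C (c t) * X (ρ (Sum.inr t))) ^ e =
      C (c t) ^ e * monomial (Finsupp.single (ρ (Sum.inl t)) l + Finsupp.single (ρ (Sum.inr t)) e) 1 := by
  rw [mul_pow, X_pow_eq_monomial, X_pow_eq_monomial, mul_left_comm, monomial_mul, one_mul]

omit [Fintype ι] [DecidableEq ι] in
/-- **Expansion of `P_{c''} ∘ ρ` into monomials.** [cite: Villaflorloyola2021, Proposition 5.2] -/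
theorem rename_fermatLinearCyclePolynomial_eq_sum (d : ℕ) (ρ : T ⊕ T ≃ ι ⊕ ι) (c : T → K) :
    rename ρ (fermatLinearCyclePolynomial c (d - 1)) =
      ∑ l ∈ Fintype.piFinset (fun _ : T => range (d - 1)),
        C (∏ t, c t ^ (d - 2 - l t)) * monomial (slotExp d ρ l) 1 := by
  simp only [fermatLinearCyclePolynomial, fermatLinearCycleFactor, map_prod, map_sum, map_mul, map_pow, rename_X,
    rename_C]
  rw [Finset.prod_univ_sum]
  refine Finset.sum_congr rfl fun l _ => ?_
  rw [slotExp, monomial_sum_one, ← Finset.prod_mul_distrib]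
  refine Finset.prod_congr rfl fun t _ => ?_
  rw [show d - 1 - 1 - l t = d - 2 - l t by omega, term_eq_monomial]

/-- **The closed formula**: `ℓ_a(P_{c''} ∘ ρ) = periodSum d ρ a c''`.
[cite: Villaflorloyola2021, Propositions 5.1 and 5.2] [cite: MovasatiVillaflor2018, Theorem 1] -/
theorem fermatLinearCycleFunctional_rename_eq_periodSum (d : ℕ) (ρ : T ⊕ T ≃ ι ⊕ ι) (a : ι → K) (c : T → K) :
    fermatLinearCycleFunctional a (d - 1) (rename ρ (fermatLinearCyclePolynomial c (d - 1))) = periodSum d ρ a c := by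
  rw [rename_fermatLinearCyclePolynomial_eq_sum, map_sum, periodSum]
  refine Finset.sum_congr rfl fun l _ => ?_
  rw [C_mul', map_smul, fermatLinearCycleFunctional_monomial, smul_eq_mul, show d - 1 - 1 = d - 2 by omega]
  split_ifs <;> simp

omit [Fintype ι] [Fintype T] [DecidableEq ι] [DecidableEq T] in
/-- `x^{−1}` to a power `u ≤ n`, as `x^{n−u} · x^{−n}`. [folklore] -/
private theorem inv_pow_eq_pow_mul_inv {x : K} (hx : x ≠ 0) {u n : ℕ} (hu : u ≤ n) :
    x⁻¹ ^ u = x ^ (n - u) * (x ^ n)⁻¹ := by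
  rw [eq_mul_inv_iff_mul_eq₀ (pow_ne_zero _ hx), inv_pow, ← Nat.sub_add_cancel hu, pow_add,
    Nat.add_sub_cancel, mul_comm (x ^ (n - u)), ← mul_assoc, inv_mul_cancel₀ (pow_ne_zero _ hx), one_mul]

/-- **Inversion symmetry**: `periodSum(a^{−1}, c''^{−1}) = ((∏ a)(∏ c''))^{−(d−2)} · periodSum(a, c'')`
(reindex by `l ↦ d − 2 − l`, which complements every exponent).
[cite: DuquefrancoVillaflorloyola2023, Theorem 5.3 (proof)] [cite: Villaflorloyola2021, §6] -/
theorem periodSum_inv_inv {d : ℕ} (hd : 2 ≤ d) (ρ : T ⊕ T ≃ ι ⊕ ι) {a : ι → K} {c : T → K} (ha : ∀ j, a j ≠ 0)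
    (hc : ∀ t, c t ≠ 0) :
    periodSum d ρ a⁻¹ c⁻¹ = (((∏ j, a j) * ∏ t, c t) ^ (d - 2))⁻¹ * periodSum d ρ a c := by
  rw [periodSum, periodSum, Finset.mul_sum]
  have hmem : ∀ l : T → ℕ, l ∈ Fintype.piFinset (fun _ : T => range (d - 1)) ↔ ∀ t, l t ≤ d - 2 := by
    intro l
    rw [Fintype.mem_piFinset]
    simp only [Finset.mem_range]
    constructor
    · intro h t; have := h t; omega
    · intro h t; have := h t; omega
  refine Finset.sum_nbij' (fun l t => d - 2 - l t) (fun l t => d - 2 - l t) ?_ ?_ ?_ ?_ ?_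
  · intro l _; rw [hmem]; intro t; exact Nat.sub_le _ _
  · intro l _; rw [hmem]; intro t; exact Nat.sub_le _ _
  · intro l hl; rw [hmem] at hl; funext t; have := hl t; dsimp only; omega
  · intro l hl; rw [hmem] at hl; funext t; have := hl t; dsimp only; omega
  · intro l hl
    rw [hmem] at hl
    have hbar : ∀ x, slotExp d ρ (fun t => d - 2 - l t) x = d - 2 - slotExp d ρ l x := slotExp_bar d ρ hl
    have hle : ∀ x, slotExp d ρ l x ≤ d - 2 := slotExp_le d ρ hl
    simp only [hbar]
    by_cases hcond : ∀ j, slotExp d ρ l (Sum.inl j) + slotExp d ρ l (Sum.inr j) = d - 2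
    · have hcond' : ∀ j, d - 2 - slotExp d ρ l (Sum.inl j) + (d - 2 - slotExp d ρ l (Sum.inr j)) = d - 2 := by
        intro j; have := hcond j; have := hle (Sum.inl j); have := hle (Sum.inr j); omega
      rw [if_pos hcond, if_pos hcond']
      simp only [Pi.inv_apply]
      rw [Finset.prod_congr rfl fun t _ => inv_pow_eq_pow_mul_inv (hc t) (Nat.sub_le (d - 2) (l t)),
        Finset.prod_congr rfl fun j _ => inv_pow_eq_pow_mul_inv (ha j) (hle (Sum.inl j)),
        Finset.prod_mul_distrib, Finset.prod_mul_distrib, Finset.prod_inv_distrib, Finset.prod_inv_distrib,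
        mul_pow, Finset.prod_pow, Finset.prod_pow]
      have h1 : ∀ t, d - 2 - (d - 2 - l t) = l t := fun t => by have := hl t; omega
      simp only [h1]
      have hA : (∏ j, a j ^ (d - 2)) ≠ 0 := Finset.prod_ne_zero_iff.mpr fun j _ => pow_ne_zero _ (ha j)
      have hC : (∏ t, c t ^ (d - 2)) ≠ 0 := Finset.prod_ne_zero_iff.mpr fun t _ => pow_ne_zero _ (hc t)
      field_simp
    · have hcond' : ¬ ∀ j, d - 2 - slotExp d ρ l (Sum.inl j) + (d - 2 - slotExp d ρ l (Sum.inr j)) = d - 2 := by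
        intro h; apply hcond; intro j; have := h j; have := hle (Sum.inl j); have := hle (Sum.inr j); omega
      rw [if_neg hcond, if_neg hcond', mul_zero]

omit [DecidableEq T] in
/-- **The parity step.** For `d` even and a term `l` satisfying the pairing condition of `ℓ_a`, the total weight-degree
`Σ_t (d − 2 − l_t) + Σ_j e_l(j,0)` is even: parities of exponents are constant on the pairs of BOTH pairings, so each of
the two sums is half the sum of all parities. [cite: DuquefrancoVillaflorloyola2023, Theorem 5.3 (proof)] -/
theorem even_weightDegree {d : ℕ} (hd : Even d) (ρ : T ⊕ T ≃ ι ⊕ ι) {l : T → ℕ} (hl : ∀ t, l t ≤ d - 2)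
    (hcond : ∀ j, slotExp d ρ l (Sum.inl j) + slotExp d ρ l (Sum.inr j) = d - 2) :
    Even ((∑ t, (d - 2 - l t)) + ∑ j, slotExp d ρ l (Sum.inl j)) := by
  obtain ⟨k, hk⟩ := hd
  -- parities are constant on the pairs of `λ` and on the pairs of `δ`
  have hI : ∀ j, slotExp d ρ l (Sum.inl j) % 2 = slotExp d ρ l (Sum.inr j) % 2 := by
    intro j; have := hcond j; omega
  have hT : ∀ t, l t % 2 = (d - 2 - l t) % 2 := by
    intro t; have := hl t; omega
  -- hence each transversal sum of parities is half the total
  have hsum1 : ∑ x, slotExp d ρ l x % 2 = 2 * ∑ j, slotExp d ρ l (Sum.inl j) % 2 := by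
    rw [Fintype.sum_sum_type, Finset.sum_congr rfl fun j _ => (hI j).symm, two_mul]
  have hsum2 : ∑ x, slotExp d ρ l x % 2 = 2 * ∑ t, (d - 2 - l t) % 2 := by
    rw [← Equiv.sum_comp ρ, Fintype.sum_sum_type]
    simp only [slotExp_apply_inl, slotExp_apply_inr]
    rw [Finset.sum_congr rfl fun t _ => hT t, two_mul]
  have hAB : ∑ t, (d - 2 - l t) % 2 = ∑ j, slotExp d ρ l (Sum.inl j) % 2 := by omega
  have hA : (∑ t, (d - 2 - l t)) % 2 = (∑ j, slotExp d ρ l (Sum.inl j)) % 2 := by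
    rw [Finset.sum_nat_mod, hAB, ← Finset.sum_nat_mod]
  rw [Nat.even_iff, Nat.add_mod, hA]
  omega

/-- **Sign symmetry** (`d` even): `periodSum(−a, −c'') = periodSum(a, c'')`.
[cite: DuquefrancoVillaflorloyola2023, Theorem 5.3 (proof)] [cite: Villaflorloyola2021, §6] -/
theorem periodSum_neg_neg {d : ℕ} (hd : Even d) (ρ : T ⊕ T ≃ ι ⊕ ι) (a : ι → K) (c : T → K) :
    periodSum d ρ (-a) (-c) = periodSum d ρ a c := by
  rw [periodSum, periodSum]
  refine Finset.sum_congr rfl fun l hl => ?_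
  have hl' : ∀ t, l t ≤ d - 2 := by
    intro t
    have := Fintype.mem_piFinset.mp hl t
    rw [Finset.mem_range] at this
    omega
  by_cases hcond : ∀ j, slotExp d ρ l (Sum.inl j) + slotExp d ρ l (Sum.inr j) = d - 2
  · rw [if_pos hcond, if_pos hcond]
    simp only [Pi.neg_apply]
    rw [Finset.prod_congr rfl fun t _ => neg_pow (c t) _, Finset.prod_congr rfl fun j _ => neg_pow (a j) _,
      Finset.prod_mul_distrib, Finset.prod_mul_distrib, Finset.prod_pow_eq_pow_sum, Finset.prod_pow_eq_pow_sum,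
      mul_mul_mul_comm, ← pow_add, (even_weightDegree hd ρ hl' hcond).neg_one_pow, one_mul]
  · rw [if_neg hcond, if_neg hcond]

omit [DecidableEq ι] in
/-- **Functoriality**: ring homomorphisms commute with `periodSum`. [cite: DuquefrancoVillaflorloyola2023, Definition 3.2] -/
theorem map_periodSum {L : Type*} [Field L] {F : Type*} [FunLike F K L] [RingHomClass F K L] (f : F) (d : ℕ)
    (ρ : T ⊕ T ≃ ι ⊕ ι) (a : ι → K) (c : T → K) :
    f (periodSum d ρ a c) = periodSum d ρ (f ∘ a) (f ∘ c) := by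
  rw [periodSum, periodSum, map_sum]
  refine Finset.sum_congr rfl fun l _ => ?_
  split_ifs
  · simp [map_mul, map_prod, map_pow]
  · simp

end PeriodSum

/-! ## The Galois action (Thms. 5.2–5.4) -/

section Galois

variable {E : Type*} [Field E] [Algebra ℚ E]

/-- An automorphism sends `ζ` to `ζ^i` with `i` coprime to `2d`. [cite: DuquefrancoVillaflorloyola2023, Proposition 3.2] -/
theorem aut_apply_eq_pow {d : ℕ} (hd : 0 < d) {ζ : E} (hζ : IsPrimitiveRoot ζ (2 * d)) (f : E ≃ₐ[ℚ] E) :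
    ∃ i < 2 * d, i.Coprime (2 * d) ∧ f ζ = ζ ^ i := by
  haveI : NeZero (2 * d) := ⟨by omega⟩
  obtain ⟨i, hi, hcop, h⟩ := (hζ.isPrimitiveRoot_iff).mp (hζ.map_of_injective f.injective)
  exact ⟨i, hi, hcop, h.symm⟩

/-- **Theorems 5.2–5.4 (the Galois action on the twists).** For `d ∈ {3,4,6}` every `f ∈ Aut(E/ℚ)` acts on the set
`ζ_{2d}^{−3}·𝕊¹_{ℚ(ζ_d)}` (which contains the genuine twists) uniformly as `w ↦ ε w` or as `w ↦ ε w̄ = ε w^{−1}`, with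
`ε = ±1` and `ε = −1` only when `d` is even: "`σ_3(α) = −ᾱ`, `σ_5(α) = −α`, `σ_7(α) = ᾱ`" (`d = 4`),
"`σ_5(α) = −ᾱ`, `σ_7(α) = −α`, `σ_11(α) = ᾱ`" (`d = 6`), "`σ(α) = ᾱ`" (`d = 3`).
[cite: DuquefrancoVillaflorloyola2023, Theorems 5.2, 5.3 and 5.4 (proofs)] -/
theorem autAction_fakeTwist {d : ℕ} (hd : d = 3 ∨ d = 4 ∨ d = 6) {ζ : E} (hζ : IsPrimitiveRoot ζ (2 * d))
    (f : E ≃ₐ[ℚ] E) :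
    ∃ ε : E, (ε = 1 ∨ (ε = -1 ∧ Even d)) ∧
      ((∀ a, IsFakeTwist d ζ a → f a = ε * a) ∨ (∀ a, IsFakeTwist d ζ a → f a = ε * a⁻¹)) := by
  have hd0 : 0 < d := by omega
  have hζ0 : ζ ≠ 0 := hζ.ne_zero (by omega)
  have hζd : ζ ^ d = -1 := pow_eq_neg_one_of_isPrimitiveRoot_two_mul hd0 hζ
  have hζ2d : ζ ^ (2 * d) = 1 := hζ.pow_eq_one
  obtain ⟨i, hi, hcop, hf⟩ := aut_apply_eq_pow hd0 hζ f
  -- the image of a fake twist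
  have himg : ∀ p q : ℚ, f ((ζ ^ 3)⁻¹ * (p + q * ζ ^ 2)) = ((ζ ^ i) ^ 3)⁻¹ * (p + q * (ζ ^ i) ^ 2) := by
    intro p q
    simp only [map_mul, map_inv₀, map_pow, map_add, map_ratCast, hf]
  -- `i = 1`: the identity
  have hid : i = 1 → ∃ ε : E, (ε = 1 ∨ (ε = -1 ∧ Even d)) ∧
      ((∀ a, IsFakeTwist d ζ a → f a = ε * a) ∨ (∀ a, IsFakeTwist d ζ a → f a = ε * a⁻¹)) := by
    intro hi'
    refine ⟨1, Or.inl rfl, Or.inl fun a ha => ?_⟩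
    obtain ⟨-, p, q, hN, rfl⟩ := ha
    rw [himg, hi', pow_one, one_mul]
  -- `i = 2d − 1` (complex conjugation): `w ↦ w̄ = w^{−1}`
  have hconj : i = 2 * d - 1 → ∃ ε : E, (ε = 1 ∨ (ε = -1 ∧ Even d)) ∧
      ((∀ a, IsFakeTwist d ζ a → f a = ε * a) ∨ (∀ a, IsFakeTwist d ζ a → f a = ε * a⁻¹)) := by
    intro hi'
    refine ⟨1, Or.inl rfl, Or.inr fun a ha => ?_⟩
    obtain ⟨-, p, q, hN, rfl⟩ := ha
    have hzi : ζ ^ i = ζ⁻¹ := by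
      refine eq_inv_of_mul_eq_one_left ?_
      rw [← pow_succ, hi', Nat.sub_add_cancel (by omega), hζ2d]
    rw [himg, fakeTwist_inv_eq hN, hzi, one_mul, inv_pow, inv_inv, inv_pow]
  rcases hd with rfl | rfl | rfl
  · -- `d = 3`: `i ∈ {1, 5}`
    interval_cases i
    · exact absurd hcop (by decide)
    · exact hid rfl
    · exact absurd hcop (by decide)
    · exact absurd hcop (by decide)
    · exact absurd hcop (by decide)
    · exact hconj rfl
  · -- `d = 4`: `i ∈ {1, 3, 5, 7}`
    have h8 : ζ ^ 8 = 1 := hζ2d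
    have h4 : ζ ^ 4 = -1 := hζd
    interval_cases i
    · exact absurd hcop (by decide)
    · exact hid rfl
    · exact absurd hcop (by decide)
    · -- `i = 3`: `σ_3(α) = −ᾱ`
      refine ⟨-1, Or.inr ⟨rfl, by decide⟩, Or.inr fun a ha => ?_⟩
      obtain ⟨-, p, q, hN, rfl⟩ := ha
      have e1 : (ζ ^ 3) ^ 3 = ζ := by linear_combination ζ * h8
      have e2 : (ζ ^ 3) ^ 2 = (ζ ^ 2)⁻¹ := eq_inv_of_mul_eq_one_left (by linear_combination h8)
      have e3 : ζ⁻¹ = -ζ ^ 3 := inv_eq_of_mul_eq_one_right (by linear_combination (-1 : E) * h4)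
      rw [himg, fakeTwist_inv_eq hN, e1, e2, e3]
      ring
    · exact absurd hcop (by decide)
    · -- `i = 5`: `σ_5(α) = −α`
      refine ⟨-1, Or.inr ⟨rfl, by decide⟩, Or.inl fun a ha => ?_⟩
      obtain ⟨-, p, q, hN, rfl⟩ := ha
      have e1 : (ζ ^ 5) ^ 2 = ζ ^ 2 := by linear_combination ζ ^ 2 * h8
      have e2 : (ζ ^ 5) ^ 3 = -ζ ^ 3 := by linear_combination ζ ^ 7 * h8 + ζ ^ 3 * h4
      rw [himg, e1, e2, inv_neg]
      ring
    · exact absurd hcop (by decide)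
    · exact hconj rfl
  · -- `d = 6`: `i ∈ {1, 5, 7, 11}`
    have h12 : ζ ^ 12 = 1 := hζ2d
    have h6 : ζ ^ 6 = -1 := hζd
    interval_cases i
    · exact absurd hcop (by decide)
    · exact hid rfl
    · exact absurd hcop (by decide)
    · exact absurd hcop (by decide)
    · exact absurd hcop (by decide)
    · -- `i = 5`: `σ_5(α) = −ᾱ`
      refine ⟨-1, Or.inr ⟨rfl, by decide⟩, Or.inr fun a ha => ?_⟩
      obtain ⟨-, p, q, hN, rfl⟩ := ha
      have e1 : (ζ ^ 5) ^ 3 = ζ ^ 3 := by linear_combination ζ ^ 3 * h12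
      have e2 : (ζ ^ 5) ^ 2 = (ζ ^ 2)⁻¹ := eq_inv_of_mul_eq_one_left (by linear_combination h12)
      have e3 : (ζ ^ 3)⁻¹ = -ζ ^ 3 := inv_eq_of_mul_eq_one_right (by linear_combination (-1 : E) * h6)
      rw [himg, fakeTwist_inv_eq hN, e1, e2, e3]
      ring
    · exact absurd hcop (by decide)
    · -- `i = 7`: `σ_7(α) = −α`
      refine ⟨-1, Or.inr ⟨rfl, by decide⟩, Or.inl fun a ha => ?_⟩
      obtain ⟨-, p, q, hN, rfl⟩ := ha
      have e1 : (ζ ^ 7) ^ 2 = ζ ^ 2 := by linear_combination ζ ^ 2 * h12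
      have e2 : (ζ ^ 7) ^ 3 = -ζ ^ 3 := by linear_combination ζ ^ 9 * h12 + ζ ^ 3 * h6
      rw [himg, e1, e2, inv_neg]
      ring
    · exact absurd hcop (by decide)
    · exact absurd hcop (by decide)
    · exact absurd hcop (by decide)
    · exact hconj rfl

variable [CharZero E] [Fintype ι] [Fintype T] [DecidableEq ι] [DecidableEq T]

/-- **The Galois group rescales the period by a factor independent of the linear cycle.** For fake twists `a_j` and
every `f ∈ Aut(E/ℚ)` there is `μ_f ≠ 0` with `f((∏ c'')·periodSum d ρ a c'') = μ_f · (∏ c'')·periodSum d ρ a c''` for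
ALL linear cycles `(ρ, c'')` (`c''_t^d = −1`): `μ_f = ε^{#T}` if `f` acts by `w ↦ εw`, and
`μ_f = ε^{#T}(−1)^{#T}(∏ a_j)^{−(d−2)}` if `f` acts by `w ↦ εw^{−1}`.
[cite: DuquefrancoVillaflorloyola2023, Theorems 5.2, 5.3 and 5.4 (proofs)] [cite: Villaflorloyola2021, §6] -/
theorem aut_prod_mul_periodSum {d : ℕ} (hd : d = 3 ∨ d = 4 ∨ d = 6) {ζ : E} (hζ : IsPrimitiveRoot ζ (2 * d))
    (a : ι → E) (ha : ∀ j, IsFakeTwist d ζ (a j)) (f : E ≃ₐ[ℚ] E) :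
    ∃ μ : E, μ ≠ 0 ∧ ∀ (ρ : T ⊕ T ≃ ι ⊕ ι) (c : T → E), (∀ t, c t ^ d = -1) →
      f ((∏ t, c t) * periodSum d ρ a c) = μ * ((∏ t, c t) * periodSum d ρ a c) := by
  have hd2 : 2 ≤ d := by omega
  have hζ0 : ζ ≠ 0 := hζ.ne_zero (by omega)
  have ha0 : ∀ j, a j ≠ 0 := fun j => (ha j).ne_zero hζ0
  have hPa : (∏ j, a j) ≠ 0 := Finset.prod_ne_zero_iff.mpr fun j _ => ha0 j
  -- genuine twists: non-zero, fake, and `(∏ c)^d = (−1)^{#T}`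
  have hc0 : ∀ (c : T → E), (∀ t, c t ^ d = -1) → ∀ t, c t ≠ 0 := fun c hc t h => by
    have h' := hc t; rw [h, zero_pow (by omega)] at h'; norm_num at h'
  have hcfake : ∀ (c : T → E), (∀ t, c t ^ d = -1) → ∀ t, IsFakeTwist d ζ (c t) := fun c hc t =>
    isFakeTwist_of_pow_eq_neg_one hd hζ (hc t)
  have hcd : ∀ (c : T → E), (∀ t, c t ^ d = -1) → (∏ t, c t) ^ d = (-1) ^ Fintype.card T := fun c hc => by
    rw [← Finset.prod_pow, Finset.prod_congr rfl fun t _ => hc t, Finset.prod_const, Finset.card_univ]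
  obtain ⟨ε, hε, hact⟩ := autAction_fakeTwist hd hζ f
  have hε0 : ε ≠ 0 := by rcases hε with rfl | ⟨rfl, -⟩ <;> norm_num
  -- how `periodSum` transforms under `w ↦ εw` and `w ↦ εw^{−1}`
  have hsign : ∀ (ρ : T ⊕ T ≃ ι ⊕ ι) (a' : ι → E) (c : T → E),
      periodSum d ρ (fun j => ε * a' j) (fun t => ε * c t) = periodSum d ρ a' c := by
    intro ρ a' c
    rcases hε with rfl | ⟨rfl, hev⟩
    · simp only [one_mul]
    · simp only [neg_one_mul]
      exact periodSum_neg_neg hev ρ a' c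
  rcases hact with hact | hact
  · -- `w ↦ ε w`
    refine ⟨ε ^ Fintype.card T, pow_ne_zero _ hε0, fun ρ c hc => ?_⟩
    have hfa : f ∘ a = fun j => ε * a j := funext fun j => hact _ (ha j)
    have hfc : f ∘ c = fun t => ε * c t := funext fun t => hact _ (hcfake c hc t)
    rw [map_mul, map_prod, map_periodSum, hfa, hfc, hsign, Finset.prod_congr rfl fun t _ => hact _ (hcfake c hc t),
      Finset.prod_mul_distrib, Finset.prod_const, Finset.card_univ]
    ring
  · -- `w ↦ ε w^{−1}`
    refine ⟨ε ^ Fintype.card T * (-1) ^ Fintype.card T * ((∏ j, a j) ^ (d - 2))⁻¹,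
      mul_ne_zero (mul_ne_zero (pow_ne_zero _ hε0) (pow_ne_zero _ (by norm_num)))
        (inv_ne_zero (pow_ne_zero _ hPa)), fun ρ c hc => ?_⟩
    have hPc : (∏ t, c t) ≠ 0 := Finset.prod_ne_zero_iff.mpr fun t _ => hc0 c hc t
    have hfa : f ∘ a = fun j => ε * a⁻¹ j := funext fun j => hact _ (ha j)
    have hfc : f ∘ c = fun t => ε * c⁻¹ t := funext fun t => hact _ (hcfake c hc t)
    rw [map_mul, map_prod, map_periodSum, hfa, hfc, hsign, periodSum_inv_inv hd2 ρ ha0 (hc0 c hc),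
      Finset.prod_congr rfl fun t _ => hact _ (hcfake c hc t), Finset.prod_mul_distrib, Finset.prod_const,
      Finset.card_univ, Finset.prod_inv_distrib, mul_pow, mul_inv]
    -- it remains to use `(∏ c)^d = (−1)^{#T}`
    have hsq : ((-1 : E) ^ Fintype.card T) * (-1) ^ Fintype.card T = 1 := by
      rw [← mul_pow, neg_one_mul, neg_neg, one_pow]
    have hd' : (∏ t, c t) ^ (d - 2) * (∏ t, c t) * (∏ t, c t) = (-1) ^ Fintype.card T := by
      rw [← hcd c hc, ← pow_succ, ← pow_succ, show d - 2 + 1 + 1 = d by omega]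
    have key : (∏ t, c t)⁻¹ * ((∏ t, c t) ^ (d - 2))⁻¹ = (-1) ^ Fintype.card T * ∏ t, c t := by
      rw [← mul_inv]
      refine inv_eq_of_mul_eq_one_right ?_
      linear_combination (-1) ^ Fintype.card T * hd' + hsq
    linear_combination (ε ^ Fintype.card T * ((∏ j, a j) ^ (d - 2))⁻¹ * periodSum d ρ a c) * key

variable [FiniteDimensional ℚ E] [IsGalois ℚ E]

/-- **Rationality of the ratios over a finite Galois extension of `ℚ`.** For fake twists `a_j` and two linear cycles
`(ρ₁, c₁)`, `(ρ₂, c₂)` in arbitrary position with `(∏ c₂)·periodSum(ρ₂) ≠ 0`, the ratio of the normalised periods is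
rational (fixed by every automorphism, by `aut_prod_mul_periodSum`).
[cite: DuquefrancoVillaflorloyola2023, Theorems 5.2, 5.3 and 5.4] [cite: Villaflorloyola2021, §6] -/
theorem periodSum_ratio_rational_of_isGalois {d : ℕ} (hd : d = 3 ∨ d = 4 ∨ d = 6) {ζ : E}
    (hζ : IsPrimitiveRoot ζ (2 * d)) (a : ι → E) (ha : ∀ j, IsFakeTwist d ζ (a j)) (ρ₁ ρ₂ : T ⊕ T ≃ ι ⊕ ι)
    (c₁ c₂ : T → E) (hc₁ : ∀ t, c₁ t ^ d = -1) (hc₂ : ∀ t, c₂ t ^ d = -1)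
    (hne : (∏ t, c₂ t) * periodSum d ρ₂ a c₂ ≠ 0) :
    ∃ q : ℚ, (∏ t, c₁ t) * periodSum d ρ₁ a c₁ = (q : E) * ((∏ t, c₂ t) * periodSum d ρ₂ a c₂) := by
  have hfix : ∀ f : E ≃ₐ[ℚ] E,
      f (((∏ t, c₁ t) * periodSum d ρ₁ a c₁) / ((∏ t, c₂ t) * periodSum d ρ₂ a c₂)) =
        ((∏ t, c₁ t) * periodSum d ρ₁ a c₁) / ((∏ t, c₂ t) * periodSum d ρ₂ a c₂) := by
    intro f
    obtain ⟨μ, hμ0, hμ⟩ := aut_prod_mul_periodSum (T := T) hd hζ a ha f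
    rw [map_div₀, hμ ρ₁ c₁ hc₁, hμ ρ₂ c₂ hc₂, mul_div_mul_left _ _ hμ0]
  obtain ⟨q, hq⟩ := (IsGalois.mem_range_algebraMap_iff_fixed _).mpr hfix
  refine ⟨q, ?_⟩
  rw [← eq_ratCast (algebraMap ℚ E), hq, div_mul_cancel₀ _ hne]

end Galois

/-! ## Rationality over any field of characteristic zero -/

section General

variable [CharZero K] [Fintype ι] [Fintype T] [DecidableEq ι] [DecidableEq T]

/-- **The ratio of the periods of a fake linear cycle over two linear cycles is rational** (`K` any field of
characteristic `0` containing a primitive `2d`-th root of unity `ζ`, `d ∈ {3,4,6}`; reduction to the cyclotomic field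
`ℚ⟮ζ⟯ ⊂ K`, which is finite Galois over `ℚ`). [cite: DuquefrancoVillaflorloyola2023, Theorem 1.1]
[cite: Villaflorloyola2021, §6] -/
theorem periodSum_ratio_rational {d : ℕ} (hd : d = 3 ∨ d = 4 ∨ d = 6) {ζ : K} (hζ : IsPrimitiveRoot ζ (2 * d))
    (a : ι → K) (ha : ∀ j, IsFakeTwist d ζ (a j)) (ρ₁ ρ₂ : T ⊕ T ≃ ι ⊕ ι) (c₁ c₂ : T → K)
    (hc₁ : ∀ t, c₁ t ^ d = -1) (hc₂ : ∀ t, c₂ t ^ d = -1) (hne : (∏ t, c₂ t) * periodSum d ρ₂ a c₂ ≠ 0) :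
    ∃ q : ℚ, (∏ t, c₁ t) * periodSum d ρ₁ a c₁ = (q : K) * ((∏ t, c₂ t) * periodSum d ρ₂ a c₂) := by
  have hd0 : 0 < d := by omega
  haveI : NeZero (2 * d) := ⟨by omega⟩
  -- the cyclotomic field `ℚ⟮ζ⟯ ⊂ K`
  have hint : IsIntegral ℚ ζ := .of_pow (by omega : 0 < 2 * d) (by rw [hζ.pow_eq_one]; exact isIntegral_one)
  haveI hcyc : IsCyclotomicExtension {2 * d} ℚ ℚ⟮ζ⟯ := by
    change IsCyclotomicExtension {2 * d} ℚ (ℚ⟮ζ⟯).toSubalgebra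
    rw [IntermediateField.adjoin_simple_toSubalgebra_of_isAlgebraic hint.isAlgebraic]
    exact hζ.adjoin_isCyclotomicExtension ℚ
  haveI : FiniteDimensional ℚ ℚ⟮ζ⟯ := IntermediateField.adjoin.finiteDimensional hint
  haveI : IsGalois ℚ ℚ⟮ζ⟯ := IsCyclotomicExtension.isGalois {2 * d} ℚ ℚ⟮ζ⟯
  -- the embedding and the lifted root of unity
  set φ : ℚ⟮ζ⟯ →+* K := algebraMap ℚ⟮ζ⟯ K with hφdef
  have hφ : Function.Injective φ := φ.injective
  set ζE : ℚ⟮ζ⟯ := ⟨ζ, IntermediateField.mem_adjoin_simple_self ℚ ζ⟩ with hζEdef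
  have hφζ : φ ζE = ζ := rfl
  have hζE : IsPrimitiveRoot ζE (2 * d) := IsPrimitiveRoot.coe_submonoidClass_iff.mp (by exact hζ)
  -- lift the fake twists
  have hlifta : ∃ aE : ι → ℚ⟮ζ⟯, (∀ j, φ (aE j) = a j) ∧ ∀ j, IsFakeTwist d ζE (aE j) := by
    have h : ∀ j, ∃ x : ℚ⟮ζ⟯, φ x = a j ∧ IsFakeTwist d ζE x := by
      intro j
      obtain ⟨-, p, q, hN, hj⟩ := ha j
      refine ⟨(ζE ^ 3)⁻¹ * (p + q * ζE ^ 2), ?_, hd, p, q, hφ ?_, rfl⟩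
      · rw [hj, map_mul, map_inv₀, map_pow, map_add, map_mul, map_pow, map_ratCast, map_ratCast, hφζ]
      · rw [map_mul, map_add, map_add, map_mul, map_mul, map_inv₀, map_pow, map_ratCast, map_ratCast, hφζ,
          map_one, hN]
    choose aE h1 h2 using h
    exact ⟨aE, h1, h2⟩
  obtain ⟨aE, haE, haEfake⟩ := hlifta
  -- lift the genuine twists
  have hliftc : ∀ c : T → K, (∀ t, c t ^ d = -1) →
      ∃ cE : T → ℚ⟮ζ⟯, (∀ t, φ (cE t) = c t) ∧ ∀ t, cE t ^ d = -1 := by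
    intro c hc
    have h : ∀ t, ∃ x : ℚ⟮ζ⟯, φ x = c t ∧ x ^ d = -1 := by
      intro t
      have hc2d : c t ^ (2 * d) = 1 := by rw [mul_comm, pow_mul, hc t]; norm_num
      obtain ⟨n, -, hn⟩ := hζ.eq_pow_of_pow_eq_one hc2d
      refine ⟨ζE ^ n, by rw [map_pow, hφζ, hn], hφ ?_⟩
      rw [map_pow, map_pow, hφζ, hn, hc t, map_neg, map_one]
    choose cE h1 h2 using h
    exact ⟨cE, h1, h2⟩
  obtain ⟨cE₁, hcE₁, hcE₁d⟩ := hliftc c₁ hc₁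
  obtain ⟨cE₂, hcE₂, hcE₂d⟩ := hliftc c₂ hc₂
  -- transport the normalised periods along `φ`
  have hP : ∀ (ρ : T ⊕ T ≃ ι ⊕ ι) (cE : T → ℚ⟮ζ⟯) (c : T → K), (∀ t, φ (cE t) = c t) →
      φ ((∏ t, cE t) * periodSum d ρ aE cE) = (∏ t, c t) * periodSum d ρ a c := by
    intro ρ cE c hcE
    rw [map_mul, map_prod, map_periodSum, Finset.prod_congr rfl fun t _ => hcE t,
      show φ ∘ aE = a from funext haE, show φ ∘ cE = c from funext hcE]
  have hneE : (∏ t, cE₂ t) * periodSum d ρ₂ aE cE₂ ≠ 0 := fun h =>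
    hne (by rw [← hP ρ₂ cE₂ c₂ hcE₂, h, map_zero])
  obtain ⟨q, hq⟩ :=
    periodSum_ratio_rational_of_isGalois hd hζE aE haEfake ρ₁ ρ₂ cE₁ cE₂ hcE₁d hcE₂d hneE
  refine ⟨q, ?_⟩
  rw [← hP ρ₁ cE₁ c₁ hcE₁, ← hP ρ₂ cE₂ c₂ hcE₂, hq, map_mul, map_ratCast]

omit [CharZero K] in
/-- The one-pair, same-position case of the period sum is Villaflor's bracket:
`periodSum d id (a) (z) = Σ_{l<d−1} a^l z^{d−2−l} = pairSum (d−1) a z`. [cite: Villaflorloyola2021, §5, proof of Theorem 1.2] -/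
theorem periodSum_refl_unit (d : ℕ) (a z : K) :
    periodSum d (Equiv.refl (Unit ⊕ Unit)) (fun _ => a) (fun _ => z) = pairSum (d - 1) a z := by
  rw [periodSum, pairSum]
  refine Finset.sum_nbij' (fun l => l ()) (fun x _ => x) ?_ ?_ ?_ ?_ ?_
  · intro l hl; exact Fintype.mem_piFinset.mp hl ()
  · intro x hx; exact Fintype.mem_piFinset.mpr fun _ => hx
  · intro l _; funext u; rfl
  · intro x _; rfl
  · intro l hl
    have hl' : l () < d - 1 := Finset.mem_range.mp (Fintype.mem_piFinset.mp hl ())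
    have h0 : slotExp d (Equiv.refl (Unit ⊕ Unit)) l (Sum.inl ()) = l () := by
      simpa using slotExp_apply_inl d (Equiv.refl (Unit ⊕ Unit)) l ()
    have h1 : slotExp d (Equiv.refl (Unit ⊕ Unit)) l (Sum.inr ()) = d - 2 - l () := by
      simpa using slotExp_apply_inr d (Equiv.refl (Unit ⊕ Unit)) l ()
    have hcond : ∀ j : Unit, slotExp d (Equiv.refl (Unit ⊕ Unit)) l (Sum.inl j) +
        slotExp d (Equiv.refl (Unit ⊕ Unit)) l (Sum.inr j) = d - 2 := by
      intro j
      rw [show j = () from rfl, h0, h1]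
      omega
    rw [if_pos hcond, Fintype.prod_unique, Fintype.prod_unique, show (default : Unit) = () from rfl, h0,
      show d - 1 - 1 - l () = d - 2 - l () by omega, mul_comm]

/-- **(arthcond1) holds on `G_d`** ("as can be easily verified", [Villaflorloyola2021] §6): for a fake twist `a` and
`d`-th roots `x, y` of `−1` with `T(x) ≠ 0`, `T = pairPeriod d a` (`T(x) = x Σ_l a^l x^{d−2−l}`, the period of the
`0`-dimensional factor), the ratio `T(y)/T(x)` is rational — the per-twist condition fed to Villaflor's Prop. 5.4,
which for `d ∉ {3,4,6}` forces `a^d = −1` (tree `pow_eq_neg_one_of_forall_ratio_rational`).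
[cite: Villaflorloyola2021, §6] [cite: DuquefrancoVillaflorloyola2023, Theorem 1.1] -/
theorem fake_pairPeriod_ratio_rational {d : ℕ} (hd : d = 3 ∨ d = 4 ∨ d = 6) {ζ : K}
    (hζ : IsPrimitiveRoot ζ (2 * d)) {a : K} (ha : IsFakeTwist d ζ a) (x y : K) (hx : x ^ d = -1)
    (hy : y ^ d = -1) (hne : pairPeriod d a x ≠ 0) :
    ∃ q : ℚ, pairPeriod d a y = (q : K) * pairPeriod d a x := by
  have key : ∀ z : K, (∏ _t : Unit, (fun _ : Unit => z) _t) *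
      periodSum d (Equiv.refl (Unit ⊕ Unit)) (fun _ => a) (fun _ => z) = pairPeriod d a z := by
    intro z
    rw [periodSum_refl_unit, Fintype.prod_unique, pairPeriod]
  have hne' : (∏ _t : Unit, (fun _ : Unit => x) _t) *
      periodSum d (Equiv.refl (Unit ⊕ Unit)) (fun _ => a) (fun _ => x) ≠ 0 := by
    rwa [key]
  obtain ⟨q, hq⟩ := periodSum_ratio_rational hd hζ (fun _ : Unit => a) (fun _ => ha) (Equiv.refl _) (Equiv.refl _)
    (fun _ => y) (fun _ => x) (fun _ => hy) (fun _ => hx) hne'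
  exact ⟨q, by rwa [key, key] at hq⟩

/-- **Fake linear cycles meet all linear cycles rationally — (H2) holds for every fake linear cycle.**
Let `K` be a field of characteristic `0`, `ζ ∈ K` a primitive `2d`-th root of unity with `d ∈ {3, 4, 6}`, and let
`ℓ = c'·ℓ_a ∘ rename θ₀^{−1}` be the functional of the pairing `θ₀` with twists `a_j ∈ ζ_{2d}^{−3}·𝕊¹_{ℚ(ζ_d)}`
(`P_λ = c_λ ∏_j (x_{θ₀(j,0)}^{d−1} − (a_j x_{θ₀(j,1)})^{d−1})/(x_{θ₀(j,0)} − a_j x_{θ₀(j,1)})`, Thm. 1.1 / the classes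
`λ_a` of [Villaflorloyola2021] §6). Then there is `c₀` such that the period `ℓ(P_δ/c_δ)` over EVERY linear cycle
`δ = (θ, c'')` of the Fermat variety (`c''_j^d = −1`, any pairing `θ`) is a rational multiple of `c₀` — verbatim the
hypothesis (H2) `hrat` of `Villaflor2022.exists_fakeLinearCycle_of_rational_periods`: "the intersection of `λ_a`
with all linear cycles contained in the Fermat variety […] is also a rational number".
[cite: DuquefrancoVillaflorloyola2023, Theorem 1.1] [cite: Villaflorloyola2021, §6] -/
theorem fakeLinearCycle_rational_periods {m k d : ℕ} (hd : d = 3 ∨ d = 4 ∨ d = 6) {ζ : K}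
    (hζ : IsPrimitiveRoot ζ (2 * d)) (θ₀ : Fin (k + 1) ⊕ Fin (k + 1) ≃ Fin m) (a : Fin (k + 1) → K)
    (ha : ∀ j, IsFakeTwist d ζ (a j)) (c' : K) :
    ∃ c₀ : K, ∀ (θ : Fin (k + 1) ⊕ Fin (k + 1) ≃ Fin m) (c'' : Fin (k + 1) → K), (∀ j, c'' j ^ d = -1) →
      ∃ q : ℚ, (c' • (fermatLinearCycleFunctional a (d - 1) ∘ₗ
          (rename θ₀.symm : MvPolynomial (Fin m) K →ₐ[K] MvPolynomial (Fin (k + 1) ⊕ Fin (k + 1)) K).toLinearMap))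
        (linearCyclePoly (d - 1) θ c'') = (q : K) * c₀ := by
  classical
  -- the value of `ℓ` on `P_δ/c_δ` is `c'·(∏ c'')·periodSum`
  have hval : ∀ (θ : Fin (k + 1) ⊕ Fin (k + 1) ≃ Fin m) (c'' : Fin (k + 1) → K),
      (c' • (fermatLinearCycleFunctional a (d - 1) ∘ₗ
          (rename θ₀.symm : MvPolynomial (Fin m) K →ₐ[K] MvPolynomial (Fin (k + 1) ⊕ Fin (k + 1)) K).toLinearMap))
        (linearCyclePoly (d - 1) θ c'') = c' * ((∏ j, c'' j) * periodSum d (θ.trans θ₀.symm) a c'') := by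
    intro θ c''
    rw [LinearMap.smul_apply, LinearMap.comp_apply, AlgHom.toLinearMap_apply, linearCyclePoly, map_mul, rename_C,
      rename_rename, fermatLinearCycleFunctional_apply, map_mul, fermatLinearCycleSubst_C, coeff_C_mul,
      ← fermatLinearCycleFunctional_apply, ← Equiv.coe_trans, fermatLinearCycleFunctional_rename_eq_periodSum,
      smul_eq_mul]
  by_cases h : ∃ (θ₂ : Fin (k + 1) ⊕ Fin (k + 1) ≃ Fin m) (c₂ : Fin (k + 1) → K), (∀ j, c₂ j ^ d = -1) ∧
      (∏ j, c₂ j) * periodSum d (θ₂.trans θ₀.symm) a c₂ ≠ 0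
  · obtain ⟨θ₂, c₂, hc₂, hne⟩ := h
    refine ⟨c' * ((∏ j, c₂ j) * periodSum d (θ₂.trans θ₀.symm) a c₂), fun θ c'' hc'' => ?_⟩
    obtain ⟨q, hq⟩ := periodSum_ratio_rational hd hζ a ha (θ.trans θ₀.symm) (θ₂.trans θ₀.symm) c'' c₂ hc'' hc₂ hne
    exact ⟨q, by rw [hval, hq]; ring⟩
  · push Not at h
    refine ⟨0, fun θ c'' hc'' => ⟨0, ?_⟩⟩
    rw [hval, h θ c'' hc'', mul_zero, Rat.cast_zero, zero_mul]

end General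


/-! ## Movasati's conjecture fails for `d = 3, 4, 6` (Thm. 1.1) — in the census vocabulary

Villaflor's Thm. 1.1 (tree `Villaflor2022.exists_linearCycleFunctional_of_rank_eq`, `d ∉ {3,4,6}`): a period
functional `ℓ` of the Fermat variety (killing `J^F`, concentrated in the socle degree) whose Movasati matrix
`[p_{i+j}]` has rank `C(n/2+d,d) − (n/2+1)²` and whose periods over all linear cycles are rational multiples of one
constant IS `c'·ℓ_{a,b}` for a linear cycle `ℙ^{n/2}_{a,b} ⊂ X^n_d`. For `d ∈ {3,4,6}` this fails: the functional
of a fake linear cycle satisfies every hypothesis — "`codim T_0V_λ = C(n/2+d,d) − (n/2+1)²`" — and is not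
proportional to the functional of any linear cycle: "Our main result disproves this conjecture for `d = 3, 4, 6` in
all dimensions […] In particular, infinitely many of these Hodge cycles are not linear cycles." -/

section Census

open Module Literature.RingTheory.MvPolynomial Literature.AlgebraicGeometry.Kloosterman2025
  Literature.AlgebraicGeometry.Movasati2016

variable [CharZero K]

omit [CharZero K] in
/-- For a bijection `θ` of variable sets, `I.map (rename θ) = I.comap (rename θ⁻¹)`. [folklore] -/
private theorem map_rename_eq_comap_rename_symm' {σ σ' : Type*} (θ : σ ≃ σ') (I : Ideal (MvPolynomial σ K)) :
    I.map (rename θ : MvPolynomial σ K →ₐ[K] MvPolynomial σ' K) =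
      I.comap (rename θ.symm : MvPolynomial σ' K →ₐ[K] MvPolynomial σ K) := by
  apply le_antisymm
  · refine Ideal.map_le_iff_le_comap.mpr fun g hg => ?_
    rw [Ideal.mem_comap, Ideal.mem_comap, rename_rename, Equiv.symm_comp_self, rename_id, AlgHom.id_apply]
    exact hg
  · intro q hq
    rw [Ideal.mem_comap] at hq
    have h : rename θ (rename θ.symm q) = q := by
      rw [rename_rename, Equiv.self_comp_symm, rename_id, AlgHom.id_apply]
    rw [← h]
    exact Ideal.mem_map_of_mem _ hq

omit [CharZero K] in
/-- The functional `ℓ_c ∘ rename θ^{−1}` of a pairing `θ` with ARBITRARY twists `c` (genuine or fake) on monomials: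
`r·∏_j c_j^{s(θ(j,0))}` if every pair of exponents sums to `d − 2`, else `0` (MV18 Thm. 1's shape; DFV Thm. 1.1's
`P_λ` for fake twists). [cite: MovasatiVillaflor2018, Theorem 1] [cite: DuquefrancoVillaflorloyola2023, Theorem 1.1] -/
theorem twistFunctional_monomial {m k d : ℕ} (θ : Fin (k + 1) ⊕ Fin (k + 1) ≃ Fin m) (c : Fin (k + 1) → K)
    (s : Fin m →₀ ℕ) (r : K) :
    (fermatLinearCycleFunctional c (d - 1) ∘ₗ
        (rename θ.symm : MvPolynomial (Fin m) K →ₐ[K] MvPolynomial (Fin (k + 1) ⊕ Fin (k + 1)) K).toLinearMap)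
      (monomial s r) =
      if ∀ j, s (θ (Sum.inl j)) + s (θ (Sum.inr j)) = d - 2 then r * ∏ j, c j ^ s (θ (Sum.inl j)) else 0 := by
  classical
  rw [LinearMap.comp_apply, AlgHom.toLinearMap_apply, rename_monomial, fermatLinearCycleFunctional_monomial,
    show d - 1 - 1 = d - 2 by omega]
  simp only [Finsupp.mapDomain_equiv_apply, Equiv.symm_symm]

/-- There is a fake twist which is not even a `2d`-th root of unity (`d ∈ {3,4,6}`): infinitely many fake twists,
finitely many roots of unity. [cite: DuquefrancoVillaflorloyola2023, Theorem 1.1] -/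
theorem exists_isFakeTwist_pow_two_mul_ne_one {d : ℕ} (hd : d = 3 ∨ d = 4 ∨ d = 6) {ζ : K}
    (hζ : IsPrimitiveRoot ζ (2 * d)) : ∃ f : K, IsFakeTwist d ζ f ∧ f ^ (2 * d) ≠ 1 := by
  have hfin : {a : K | a ^ (2 * d) = 1}.Finite := by
    refine (Polynomial.finite_setOf_isRoot (Polynomial.X_pow_sub_C_ne_zero (by omega : 0 < 2 * d) (1 : K))).subset ?_
    intro a ha
    simp only [Set.mem_setOf_eq] at ha ⊢
    rw [Polynomial.IsRoot, Polynomial.eval_sub, Polynomial.eval_pow, Polynomial.eval_X, Polynomial.eval_C, ha,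
      sub_self]
  obtain ⟨f, ⟨hf, -⟩, hf2⟩ := ((infinite_setOf_isFakeTwist_not_pow_eq hd hζ).sdiff hfin).nonempty
  exact ⟨f, hf, hf2⟩

/-- **A fake linear cycle attains Movasati's bound, meets all linear cycles rationally, and is not a linear cycle**
(Thm. 1.1 for `d ∈ {3,4,6}` at the level of the period functional; compare
`Villaflor2022.exists_linearCycleFunctional_of_rank_eq` for `d ∉ {3,4,6}`, whose hypotheses are (i)–(v) below): for
`n` even with `n + 2 ≤ (n/2)·d`, `d ∈ {3,4,6}` and `ζ` a primitive `2d`-th root of unity there is a functional `ℓ` on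
`K[x_0, …, x_{n+1}]` which (i) kills the monomials of `J^F = (x_i^{d−1})`, (ii) is concentrated in degree
`σ = (n/2+1)(d−2)`, (iii) is non-zero, (iv) has `rank [p_{i+j}(ℓ)] = C(n/2+d, d) − (n/2+1)²` for Movasati's matrix
(tree `Movasati2016.periodMatrix (n+2) d ((n/2)d−n−2) d`: "`codim T_0V_λ = C(n/2+d,d) − (n/2+1)²`"), (v) satisfies
(H2) over the linear cycles `ℙ^{n/2}_{a,b}` (`Villaflor2022.linearCyclePolyMV`), and (vi) is NOT `c'·ℓ_{a,b}` for any
linear cycle `ℙ^{n/2}_{a,b}` of the Fermat variety (tree `MovasatiVillaflor2018.linearCycleFunctional`) and any `c'`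
("infinitely many of these Hodge cycles are not linear cycles"). It is the functional of the fake linear cycle
`{x_{2j} = f x_{2j+1}}` with all twists equal to one `f ∈ ζ_{2d}^{−3}·𝕊¹_{ℚ(ζ_d)}`, `f^{2d} ≠ 1`.
[cite: DuquefrancoVillaflorloyola2023, Theorem 1.1] [cite: Villaflorloyola2021, §6] -/
theorem exists_fakeLinearCycleFunctional_rank_eq {n d : ℕ} (hn : Even n) (hd : d = 3 ∨ d = 4 ∨ d = 6)
    (hN : n + 2 ≤ n / 2 * d) {ζ : K} (hζ : IsPrimitiveRoot ζ (2 * d)) :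
    ∃ ℓ : MvPolynomial (Fin (n + 2)) K →ₗ[K] K,
      (∀ s : Fin (n + 2) →₀ ℕ, (∃ i, d - 1 ≤ s i) → ℓ (monomial s 1) = 0) ∧
      (∀ q, ℓ (homogeneousComponent ((n / 2 + 1) * (d - 2)) q) = ℓ q) ∧ ℓ ≠ 0 ∧
      (periodMatrix (n + 2) d (n / 2 * d - n - 2) d (periodVector ℓ)).rank =
        (n / 2 + d).choose d - (n / 2 + 1) ^ 2 ∧
      (∃ c₀ : K, ∀ (a : Fin (n + 2) → ℕ) (b : Equiv.Perm (Fin (n + 2))),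
        ∃ q : ℚ, ℓ (linearCyclePolyMV n d ζ a b hn) = (q : K) * c₀) ∧
      ∀ (a : Fin (n + 2) → ℕ) (b : Equiv.Perm (Fin (n + 2))) (c' : K),
        ℓ ≠ c' • linearCycleFunctional n d ζ a b hn := by
  classical
  have hk : n = 2 * (n / 2) := by obtain ⟨r, hr⟩ := hn; omega
  have hd0 : 0 < d := by omega
  have hd3 : 3 ≤ d := by omega
  have hζ0 : ζ ≠ 0 := hζ.ne_zero (by omega)
  have hζ2d : ζ ^ (2 * d) = 1 := hζ.pow_eq_one
  -- a fake twist which is not a `2d`-th root of unity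
  obtain ⟨f, hf, hf2d⟩ := exists_isFakeTwist_pow_two_mul_ne_one hd hζ
  have hf0 : f ≠ 0 := hf.ne_zero hζ0
  set θ : Fin (n / 2 + 1) ⊕ Fin (n / 2 + 1) ≃ Fin (n + 2) := pairEquiv n hn with hθ
  set cf : Fin (n / 2 + 1) → K := fun _ => f with hcf
  set ℓ : MvPolynomial (Fin (n + 2)) K →ₗ[K] K := fermatLinearCycleFunctional cf (d - 1) ∘ₗ
    (rename θ.symm : MvPolynomial (Fin (n + 2)) K →ₐ[K]
      MvPolynomial (Fin (n / 2 + 1) ⊕ Fin (n / 2 + 1)) K).toLinearMap with hℓdef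
  have hmon : ∀ (s : Fin (n + 2) →₀ ℕ) (r : K), ℓ (monomial s r) =
      if ∀ j, s (θ (Sum.inl j)) + s (θ (Sum.inr j)) = d - 2 then r * ∏ j, cf j ^ s (θ (Sum.inl j)) else 0 :=
    fun s r => twistFunctional_monomial θ cf s r
  -- (i) `ℓ` kills `J^F`
  have hbox : ∀ s : Fin (n + 2) →₀ ℕ, (∃ i, d - 1 ≤ s i) → ℓ (monomial s 1) = 0 := by
    rintro s ⟨i, hi⟩
    rw [hmon, if_neg]
    intro h
    obtain ⟨y, hy⟩ := θ.surjective i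
    rcases y with j | j
    · have := h j; rw [hy] at this; omega
    · have := h j; rw [hy] at this; omega
  -- (ii) concentration in the socle degree
  have hhom : ∀ q, ℓ (homogeneousComponent ((n / 2 + 1) * (d - 2)) q) = ℓ q := by
    intro q
    have h := fermatLinearCycleFunctional_homogeneousComponent cf (d - 1) (rename θ.symm q)
    rw [Fintype.card_fin, show d - 1 - 1 = d - 2 by omega, ← rename_homogeneousComponent] at h
    simpa only [hℓdef, LinearMap.comp_apply, AlgHom.toLinearMap_apply] using h
  -- (iii) non-zero
  have hne : ℓ ≠ 0 := by
    intro h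
    have h1 := LinearMap.congr_fun h
      (rename θ (rename Sum.inr (monomial (fermatSocleExponent (Fin (n / 2 + 1)) (d - 1)) (1 : K))))
    rw [hℓdef, LinearMap.comp_apply, AlgHom.toLinearMap_apply, rename_rename, Equiv.symm_comp_self, rename_id,
      AlgHom.id_apply, fermatLinearCycleFunctional_apply, fermatLinearCycleSubst_rename_inr, coeff_monomial,
      if_pos rfl, LinearMap.zero_apply] at h1
    exact one_ne_zero h1
  -- (iv) the rank of Movasati's matrix
  have hann : annIdeal ℓ = (fermatLinearCycleIdeal cf (d - 1)).map
      (rename θ : MvPolynomial (Fin (n / 2 + 1) ⊕ Fin (n / 2 + 1)) K →ₐ[K] MvPolynomial (Fin (n + 2)) K) := by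
    rw [hℓdef, annIdeal_comp_of_surjective _ (rename_surjective _ θ.symm.surjective),
      annIdeal_fermatLinearCycleFunctional _ _ (by omega), map_rename_eq_comap_rename_symm']
  have hrank : (periodMatrix (n + 2) d (n / 2 * d - n - 2) d (periodVector ℓ)).rank =
      (n / 2 + d).choose d - (n / 2 + 1) ^ 2 := by
    have hdeg : d + (n / 2 * d - n - 2) = (n / 2 + 1) * (d - 2) := by
      obtain ⟨d', rfl⟩ : ∃ d', d = d' + 3 := ⟨d - 3, by omega⟩
      have e1 : (n / 2 + 1) * (d' + 3 - 2) = n / 2 * d' + n / 2 + d' + 1 := by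
        rw [show d' + 3 - 2 = d' + 1 by omega]; ring
      have e2 : n / 2 * (d' + 3) = n / 2 * d' + 3 * (n / 2) := by ring
      rw [e2] at hN
      rw [e1, e2]
      omega
    rw [rank_periodMatrix_eq_hilbert ℓ hbox hhom hdeg, hann, hilbert_map_rename_equiv,
      hilbert_fermatLinearCycleIdeal_eq_card _ _ (by omega)]
    have hbox' := HodgeTheory.card_filter_finsuppAntidiag_eq_ciHilbert (fun _ : Fin (n / 2 + 1) => d - 1)
      (fun _ => by omega) d
    have h := DuqueFrancoVillaflor2025.linearCycleHF_self (n / 2) d hd3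
    rw [DuqueFrancoVillaflor2025.linearCycleHF_eq_ciHilbert, ← List.ofFn_const, Nat.choose_symm_add] at h
    have h' : ((Finset.univ.finsuppAntidiag d).filter fun β : Fin (n / 2 + 1) →₀ ℕ => ∀ i, β i ≤ d - 1 - 1).card =
        (n / 2 + d).choose d - (n / 2 + 1) ^ 2 := by
      rw [hbox']
      exact Nat.eq_sub_of_add_eq h
    convert h' using 4
  -- (v) rational periods over all linear cycles
  have hrat : ∃ c₀ : K, ∀ (a : Fin (n + 2) → ℕ) (b : Equiv.Perm (Fin (n + 2))),
      ∃ q : ℚ, ℓ (linearCyclePolyMV n d ζ a b hn) = (q : K) * c₀ := by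
    obtain ⟨c₀, hc₀⟩ := fakeLinearCycle_rational_periods hd hζ θ cf (fun _ => hf) (1 : K)
    refine ⟨c₀, fun a b => ?_⟩
    have htw : ∀ j, MovasatiVillaflor2018.twist n ζ a j ^ d = -1 := by
      intro j
      rw [MovasatiVillaflor2018.twist, ← pow_mul,
        show (1 + 2 * a ⟨2 * (j : ℕ) + 1, by omega⟩) * d = d + 2 * d * a ⟨2 * (j : ℕ) + 1, by omega⟩ by ring,
        pow_add, pow_mul, hζ2d, one_pow, mul_one, pow_eq_neg_one_of_isPrimitiveRoot_two_mul hd0 hζ]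
    obtain ⟨q, hq⟩ := hc₀ ((pairEquiv n hn).trans b) (MovasatiVillaflor2018.twist n ζ a) htw
    refine ⟨q, ?_⟩
    rw [← hq, one_smul, linearCyclePolyMV]
  refine ⟨ℓ, hbox, hhom, hne, hrank, hrat, fun a b c' hEq => ?_⟩
  -- (vi) two test monomials `x_0 x_1^{d−3} M` and `x_1^{d−2} M`, `M = ∏_{e ≥ 1} x_{2e}^{d−2}`
  set g₂ : Fin (n + 2) → ℕ := fun x => if (x : ℕ) = 1 then d - 2 else
    if (x : ℕ) % 2 = 0 ∧ (x : ℕ) ≠ 0 then d - 2 else 0 with hg₂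
  set g₁ : Fin (n + 2) → ℕ := fun x => if (x : ℕ) = 0 then 1 else if (x : ℕ) = 1 then d - 3 else
    if (x : ℕ) % 2 = 0 then d - 2 else 0 with hg₁
  set s₂ : Fin (n + 2) →₀ ℕ := Finsupp.equivFunOnFinite.symm g₂ with hs₂
  set s₁ : Fin (n + 2) →₀ ℕ := Finsupp.equivFunOnFinite.symm g₁ with hs₁
  -- their values under `ℓ`
  have hθl : ∀ j : Fin (n / 2 + 1), ((θ (Sum.inl j) : Fin (n + 2)) : ℕ) = 2 * j := fun j => by
    rw [hθ, pairEquiv_inl]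
  have hθr : ∀ j : Fin (n / 2 + 1), ((θ (Sum.inr j) : Fin (n + 2)) : ℕ) = 2 * j + 1 := fun j => by
    rw [hθ, pairEquiv_inr]
  have v₂l : ∀ j : Fin (n / 2 + 1), s₂ (θ (Sum.inl j)) = if (j : ℕ) = 0 then 0 else d - 2 := by
    intro j
    rw [hs₂, Finsupp.coe_equivFunOnFinite_symm, hg₂]
    simp only [hθl]
    split_ifs <;> omega
  have v₂r : ∀ j : Fin (n / 2 + 1), s₂ (θ (Sum.inr j)) = if (j : ℕ) = 0 then d - 2 else 0 := by
    intro j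
    rw [hs₂, Finsupp.coe_equivFunOnFinite_symm, hg₂]
    simp only [hθr]
    split_ifs <;> omega
  have v₁l : ∀ j : Fin (n / 2 + 1), s₁ (θ (Sum.inl j)) = if (j : ℕ) = 0 then 1 else d - 2 := by
    intro j
    rw [hs₁, Finsupp.coe_equivFunOnFinite_symm, hg₁]
    simp only [hθl]
    split_ifs <;> omega
  have v₁r : ∀ j : Fin (n / 2 + 1), s₁ (θ (Sum.inr j)) = if (j : ℕ) = 0 then d - 3 else 0 := by
    intro j
    rw [hs₁, Finsupp.coe_equivFunOnFinite_symm, hg₁]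
    simp only [hθr]
    split_ifs <;> first | omega | contradiction
  have hℓ₂ : ℓ (monomial s₂ 1) = ∏ j : Fin (n / 2 + 1), f ^ s₂ (θ (Sum.inl j)) := by
    rw [hmon, if_pos, one_mul]
    intro j; rw [v₂l, v₂r]; split_ifs <;> omega
  have hℓ₁ : ℓ (monomial s₁ 1) = f * ∏ j : Fin (n / 2 + 1), f ^ s₂ (θ (Sum.inl j)) := by
    have hsucc : ∀ j : Fin (n / 2), ((j.succ : Fin (n / 2 + 1)) : ℕ) ≠ 0 := fun j => by
      rw [Fin.val_succ]; omega
    rw [hmon, if_pos, one_mul, Fin.prod_univ_succ, Fin.prod_univ_succ, v₁l, v₂l]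
    · simp only [Fin.val_zero, if_true, pow_one, pow_zero, one_mul]
      congr 1
      refine Finset.prod_congr rfl fun j _ => ?_
      rw [v₁l, v₂l, if_neg (hsucc j), if_neg (hsucc j)]
    · intro j; rw [v₁l, v₁r]; split_ifs <;> omega
  have hP0 : (∏ j : Fin (n / 2 + 1), f ^ s₂ (θ (Sum.inl j))) ≠ 0 :=
    Finset.prod_ne_zero_iff.mpr fun j _ => pow_ne_zero _ hf0
  -- their values under `c'·ℓ_{a,b}`: `0` or `± c' ζ^E`
  have hL : ∀ s : Fin (n + 2) →₀ ℕ, (c' • linearCycleFunctional n d ζ a b hn) (monomial s 1) = 0 ∨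
      ∃ E : ℕ, (c' • linearCycleFunctional n d ζ a b hn) (monomial s 1) =
        c' * ((Equiv.Perm.sign b : ℤ) : K) * ζ ^ E := by
    intro s
    rw [LinearMap.smul_apply, linearCycleFunctional_monomial, smul_eq_mul, one_mul, linearCyclePeriod]
    split_ifs with hc
    · exact Or.inr ⟨_, by rw [mul_assoc]⟩
    · exact Or.inl (mul_zero _)
  have e₂ := LinearMap.congr_fun hEq (monomial s₂ 1)
  have e₁ := LinearMap.congr_fun hEq (monomial s₁ 1)
  rw [hℓ₂] at e₂
  rw [hℓ₁] at e₁
  rcases hL s₂ with h0 | ⟨E₂, hE₂⟩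
  · exact hP0 (e₂.trans h0)
  rcases hL s₁ with h0 | ⟨E₁, hE₁⟩
  · exact mul_ne_zero hf0 hP0 (e₁.trans h0)
  rw [hE₂] at e₂
  rw [hE₁] at e₁
  -- `f · ζ^{E₂} = ζ^{E₁}`, so `f^{2d} = 1`
  have hcs : c' * ((Equiv.Perm.sign b : ℤ) : K) ≠ 0 := by
    intro h0
    rw [h0, zero_mul] at e₂
    exact hP0 e₂
  have key : f * ζ ^ E₂ = ζ ^ E₁ := by
    apply mul_left_cancel₀ hcs
    linear_combination e₁ - f * e₂
  apply hf2d
  have h2 : f ^ (2 * d) * (ζ ^ (2 * d)) ^ E₂ = (ζ ^ (2 * d)) ^ E₁ := by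
    rw [← pow_right_comm ζ E₂ (2 * d), ← pow_right_comm ζ E₁ (2 * d), ← mul_pow, key]
  rw [hζ2d, one_pow, one_pow, mul_one] at h2
  exact h2

end Census

/-! ## The same pairing: the exact value `(1 − d)^{#{t : a_t = c_t}}` ([Villaflor2022PeriodsCI] Cor. 4)

For two GENUINE linear cycles with the same pairing, `ℙ_a = {x_{t,0} = a_t x_{t,1}}` and `ℙ_c = {x_{t,0} = c_t x_{t,1}}`
(`a_t^d = −1 = c_t^d`), the period sum factorises over the pairs (`periodSum_refl`), and each pair contributes, after
the normalisation by `a_t c_t`, exactly Cor. 4's dichotomy: "`Σ_{l=0}^{d−2} ζ^{α(l+1)+β(d−1−l)} = 1 − d` if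
`α_{2j−2} = β_{2j−2}`, `1` if `α_{2j−2} ≠ β_{2j−2}`" (`mul_mul_pairSum_eq`; with `a = ζ^α`, `c = ζ^β` the summand
`a c · a^l c^{d−2−l}` is `ζ^{α(l+1)+β(d−1−l)}`), whence "`c(d−1)^{n+2} = (1−d)^{m+1}`", i.e.
`(∏_t a_t)(∏_t c_t)·ℓ_a(P_c) = (1 − d)^{#{t : a_t = c_t}}` (`prod_mul_fermatLinearCycleFunctional_eq`) — the algebraic
shadow of `ℙ_α·ℙ_β = (1 − (1−d)^{m+1})/d`, `m = dim ℙ_α ∩ ℙ_β` (`m + 1 = #{t : a_t = c_t}`), the constants `d^{n/2+1}`,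
`c_δ` and the transcendental normalisation being dropped as everywhere in the tree (cf. the integrality without closed
form for ARBITRARY position, `Villaflor2022.linearCyclePairing_integral`). -/

section SamePairing

variable [Fintype T] [DecidableEq T]

/-- For the identity pairing the period sum factorises over the pairs:
`periodSum d id a c = ∏_t pairSum (d−1) a_t c_t` (`pairSum (d−1) a z = Σ_{l<d−1} a^l z^{d−2−l}`); valid for all
`a, c` over any field. [cite: Villaflor2022PeriodsCI, Corollary 4 (proof)] [cite: Villaflorloyola2021, Proposition 5.2] -/
theorem periodSum_refl (d : ℕ) (a c : T → K) :
    periodSum d (Equiv.refl (T ⊕ T)) a c = ∏ t, pairSum (d - 1) (a t) (c t) := by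
  rw [periodSum]
  simp only [pairSum]
  rw [Finset.prod_univ_sum]
  refine Finset.sum_congr rfl fun l hl => ?_
  have hl' : ∀ t, l t < d - 1 := fun t => Finset.mem_range.mp (Fintype.mem_piFinset.mp hl t)
  have h0 : ∀ t, slotExp d (Equiv.refl (T ⊕ T)) l (Sum.inl t) = l t := fun t => by
    simpa using slotExp_apply_inl d (Equiv.refl (T ⊕ T)) l t
  have h1 : ∀ t, slotExp d (Equiv.refl (T ⊕ T)) l (Sum.inr t) = d - 2 - l t := fun t => by
    simpa using slotExp_apply_inr d (Equiv.refl (T ⊕ T)) l t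
  have hcond : ∀ j, slotExp d (Equiv.refl (T ⊕ T)) l (Sum.inl j) +
      slotExp d (Equiv.refl (T ⊕ T)) l (Sum.inr j) = d - 2 := by
    intro j
    rw [h0, h1]
    have := hl' j
    omega
  rw [if_pos hcond, ← Finset.prod_mul_distrib]
  refine Finset.prod_congr rfl fun t _ => ?_
  rw [h0, show d - 1 - 1 - l t = d - 2 - l t by omega, mul_comm]

/-- **Cor. 4's dichotomy per pair.** For `d`-th roots `a, c` of `−1` (`d ≥ 2`):
`a c · Σ_{l<d−1} a^l c^{d−2−l} = 1 − d` if `a = c` and `= 1` if `a ≠ c` ("`Σ_{l=0}^{d−2} ζ^{α(l+1)+β(d−1−l)} = 1 − d`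
if `α_{2j−2} = β_{2j−2}`, `1` if `α_{2j−2} ≠ β_{2j−2}`": `(d−1)a^d = 1 − d`, resp. `a c (a^{d−1} − c^{d−1})/(a − c) =
(c a^d − a c^d)/(a − c) = 1`). [cite: Villaflor2022PeriodsCI, Corollary 4 (proof)] -/
theorem mul_mul_pairSum_eq [DecidableEq K] {d : ℕ} (hd : 2 ≤ d) {a c : K} (ha : a ^ d = -1) (hc : c ^ d = -1) :
    a * c * pairSum (d - 1) a c = if a = c then 1 - (d : K) else 1 := by
  split_ifs with h
  · subst h
    rw [pairSum_self, show d - 1 - 1 = d - 2 by omega, Nat.cast_sub (by omega : 1 ≤ d), Nat.cast_one]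
    have h3 : a * a * a ^ (d - 2) = a ^ d := by
      rw [← pow_two, ← pow_add, show 2 + (d - 2) = d by omega]
    calc a * a * ((d - 1 : K) * a ^ (d - 2)) = (d - 1 : K) * (a * a * a ^ (d - 2)) := by ring
      _ = 1 - d := by rw [h3, ha]; ring
  · have hac : a - c ≠ 0 := sub_ne_zero.mpr h
    apply mul_right_cancel₀ hac
    have had : a * a ^ (d - 1) = a ^ d := by rw [← pow_succ', show d - 1 + 1 = d by omega]
    have hcd : c * c ^ (d - 1) = c ^ d := by rw [← pow_succ', show d - 1 + 1 = d by omega]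
    rw [one_mul, mul_assoc, pairSum_mul_sub]
    calc a * c * (a ^ (d - 1) - c ^ (d - 1)) = c * (a * a ^ (d - 1)) - a * (c * c ^ (d - 1)) := by ring
      _ = a - c := by rw [had, hcd, ha, hc]; ring

/-- **[Villaflor2022PeriodsCI] Cor. 4, the normalised period sum of two linear cycles with the same pairing:**
`(∏_t a_t)(∏_t c_t)·periodSum d id a c = (1 − d)^{#{t : a_t = c_t}}` for genuine twists (`a_t^d = −1 = c_t^d`,
`d ≥ 2`) — "`c(d−1)^{n+2} = (1−d)^{m+1}`", `m + 1 = #{t : a_t = c_t} = dim(ℙ_a ∩ ℙ_c) + 1`.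
[cite: Villaflor2022PeriodsCI, Corollary 4] [cite: MovasatiVillaflor2018, Theorem 1] -/
theorem prod_mul_periodSum_refl [DecidableEq K] {d : ℕ} (hd : 2 ≤ d) (a c : T → K) (ha : ∀ t, a t ^ d = -1)
    (hc : ∀ t, c t ^ d = -1) :
    ((∏ t, a t) * ∏ t, c t) * periodSum d (Equiv.refl (T ⊕ T)) a c =
      (1 - d : K) ^ (univ.filter fun t => a t = c t).card := by
  rw [periodSum_refl, ← Finset.prod_mul_distrib, ← Finset.prod_mul_distrib,
    Finset.prod_congr rfl fun t _ => mul_mul_pairSum_eq hd (ha t) (hc t), Finset.prod_ite, Finset.prod_const,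
    Finset.prod_const_one, mul_one]

/-- **The pairing of two linear cycles with the same pairing, exactly** (functional level): for genuine twists
`a, c : T → K` (`a_t^d = −1 = c_t^d`, `d ≥ 2`),
`(∏_t a_t)(∏_t c_t) · ℓ_a(P_c) = (1 − d)^{#{t : a_t = c_t}}`, where `ℓ_a = fermatLinearCycleFunctional a (d−1)` is the
functional of `ℙ_a` and `P_c = fermatLinearCyclePolynomial c (d−1) = ∏_t Σ_l x_{t,0}^l (c_t x_{t,1})^{d−2−l}` the
normalised polynomial of `ℙ_c` — the algebraic shadow of "`ℙ_α·ℙ_β = (1 − (1−d)^{m+1})/d` where `m = dim ℙ_α ∩ ℙ_β`".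
In particular the value is `(1−d)^{#T}` on the cycle itself and `1` when all twists differ (`ℙ_a ∩ ℙ_c = ∅`).
[cite: Villaflor2022PeriodsCI, Corollary 4] [cite: Villaflorloyola2021, Propositions 5.1 and 5.2]
[cite: MovasatiVillaflor2018, Theorem 1] -/
theorem prod_mul_fermatLinearCycleFunctional_eq [DecidableEq K] {d : ℕ} (hd : 2 ≤ d) (a c : T → K)
    (ha : ∀ t, a t ^ d = -1) (hc : ∀ t, c t ^ d = -1) :
    ((∏ t, a t) * ∏ t, c t) * fermatLinearCycleFunctional a (d - 1) (fermatLinearCyclePolynomial c (d - 1)) =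
      (1 - d : K) ^ (univ.filter fun t => a t = c t).card := by
  have h := fermatLinearCycleFunctional_rename_eq_periodSum d (Equiv.refl (T ⊕ T)) a c
  rw [Equiv.coe_refl, rename_id_apply] at h
  rw [h, prod_mul_periodSum_refl hd a c ha hc]

/-- The two extreme cases: `(∏ a)²·ℓ_a(P_a) = (1 − d)^{#T}` (the cycle against itself) and, for twists differing in
every pair, `(∏ a)(∏ c)·ℓ_a(P_c) = 1`. [cite: Villaflor2022PeriodsCI, Corollary 4] -/
theorem prod_mul_fermatLinearCycleFunctional_self {d : ℕ} (hd : 2 ≤ d) (a : T → K) (ha : ∀ t, a t ^ d = -1) :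
    ((∏ t, a t) * ∏ t, a t) * fermatLinearCycleFunctional a (d - 1) (fermatLinearCyclePolynomial a (d - 1)) =
      (1 - d : K) ^ Fintype.card T := by
  classical
  rw [prod_mul_fermatLinearCycleFunctional_eq hd a a ha ha, Finset.filter_true_of_mem fun t _ => rfl,
    Finset.card_univ]

/-- Twists differing in every pair (`ℙ_a ∩ ℙ_c = ∅`): the normalised pairing is `1`.
[cite: Villaflor2022PeriodsCI, Corollary 4] -/
theorem prod_mul_fermatLinearCycleFunctional_of_forall_ne {d : ℕ} (hd : 2 ≤ d) (a c : T → K)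
    (ha : ∀ t, a t ^ d = -1) (hc : ∀ t, c t ^ d = -1) (hne : ∀ t, a t ≠ c t) :
    ((∏ t, a t) * ∏ t, c t) * fermatLinearCycleFunctional a (d - 1) (fermatLinearCyclePolynomial c (d - 1)) = 1 := by
  classical
  rw [prod_mul_fermatLinearCycleFunctional_eq hd a c ha hc, Finset.filter_false_of_mem fun t _ => hne t,
    Finset.card_empty, pow_zero]

end SamePairing

end Literature.AlgebraicGeometry.DuqueFrancoVillaflor2023

end
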